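import Literature.NumberTheory.Sieve.PolynomialCongruencesLemmas
import Literature.NumberTheory.Sieve.PolynomialCongruencesRootCount
import Literature.NumberTheory.Sieve.SmoothRoughDecomposition
import Literature.NumberTheory.Sieve.RoughNumbersInProgressions
import HarnessLib

/-!
# Hooley's theorem on the roots of polynomial congruences: the proof

Topic `Literature/NumberTheory/Sieve`.  This file DISCHARGES the named fact
`Literature.NumberTheory.Sieve.hooley_polyRoots_equidistributed` of `PolynomialCongruences.lean`:

> (Hooley 1964) for `f ∈ ℤ[X]` irreducible of degree `n ≥ 2` and every integer `h ≠ 0`,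
> `∑_{d ≤ D} ∑_{ν mod d, f(ν) ≡ 0 (d)} e(hν/d) = o(D)`,

as `hooley_polyRoots_equidistributed_holds` (no `sorry`, no new axioms).  The original paper
(C. Hooley, *On the distribution of the roots of polynomial congruences*, Mathematika 11 (1964)
39–49) is not held in the literature store; the proof formalised here follows the architecture of
Hooley's argument as reported by Martin–Sitar, Mathematika 57 (2011) §3.2 ("Outline of proof"),
and Dartyge–Martin, Discrete Analysis 2019:15, Lemma 5, with cruder (but sufficient) bookkeeping
of the exponents.  Write `ρ = ρ_f`, `S(h, k) = S_f(h, k) = polyRootWeylSum f k h`,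
`R(x) = ∑_{k ≤ x} S(h, k)`.

## The argument

Fix a parameter `z` (eventually `log z = log x / (ε log log x)`) and factor every `1 ≤ k ≤ x`
uniquely as `k = a b` with `a` the `⌈z⌉₊`-smooth part and `b` the rough part
(`sum_Icc_eq_sum_smooth_sum_rough`, file `SmoothRoughDecomposition.lean`), so that
`R(x) = ∑_{a smooth ≤ x} T(a)`, `T(a) = ∑_{b ∈ roughIcc ⌈z⌉₊ (x/a)} S(h, ab)`.

* (Lemma 4) `ρ(k) ≤ C n^{ω(k)}` (`exists_polyRootCountMod_le_mul_pow_card_primeFactors`, from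
  multiplicativity, Hensel at the good primes and the Nagell-type bound, files
  `PolynomialCongruencesLemmas/RootCount.lean`); for a rough `b ≤ x` this gives the uniform
  `ρ(b) ≤ Ξ := C n^{log x / log z}` (`polyRootCountMod_le_of_rough`).
* (`Σ₂`, smooth part `a > x^{1/3}`) `|T(a)| ≤ ρ(a) Ξ · x/a`, and Rankin's trick
  (`sum_div_le_rankin`) with Mertens for `ρ` and `∑_{p ≤ y} log p/p ≤ log y + log 4` gives
  `∑_{a smooth > x^{1/3}} ρ(a)/a ≤ C e^{B t e^t} (log z) x^{-t/(3 log z)}`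
  (`exists_sum_smooth_rootCount_div_le`, Hooley's Lemmas 5 and 7).
* (`Σ₁`, smooth part `a ≤ x^{1/3}`) by Lemma 1 `|S(h, ab)| ≤ ρ(b) |S(h b̄, a)|`, and by
  Cauchy–Schwarz `|T(a)|² ≤ Σ₅ Σ₆` with `Σ₅ = ∑_b ρ(b)² ≤ Ξ² #{b ≤ x/a rough}` and
  `Σ₆ = ∑_b |S(h b̄, a)|² ≤ (max_s #{b ≤ x/a rough, b ≡ s (a)}) · (h, a) a ρ(a)` (the twisted
  second moment `sum_range_norm_sq_polyRootWeylSum_mul_le`, "his equation (9)").  The rough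
  numbers in a progression to the smooth modulus `a` are counted by the beta-sieve
  (`card_roughAP_le_of_smooth`, file `RoughNumbersInProgressions.lean`, Hooley's Lemma 8):
  `≪ (x/a)/(φ(a) log z) + z^{10}`, and `z^{10}` is absorbed when `z^{10} log z ≤ x^{1/3}`.  Hence
  `|T(a)| ≤ 2K √|h| Ξ (x/a) (log z)^{-1} √(ρ(a) a/φ(a))`, and the smooth sum
  `∑_a √(ρ(a) a/φ(a))/a ≤ C (log z)^{1-δ}` (`exists_sum_smooth_sqrt_rootCount_div_le`) carries
  the saving: `√ρ(p) ≤ ρ(p) − (n − √n) 1_{ρ(p) = n}`, Mertens for `ρ`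
  (`exists_sum_primesLE_rootCount_div_le`) and the positive `∑ 1/p`-density of the primes with
  `ρ(p) = n` (`exists_loglog_le_sum_inv_primes_rootCount_eq_natDegree`, Hooley's Lemma 6) give
  `δ = min(c(n − √n), 1/2) > 0` (Hooley: `δ_n = (n − √n)/n!`).
* Together (`exists_norm_sum_polyRootWeylSum_le`):
  `|R(x)| ≤ n^{log x/log z} x (A₁ (log z)^{-δ} + A₂ e^{Bte^t} (log z) e^{-(t/3) log x/log z})`; with
  `log z = log x/(ε s)`, `s = log log x`, `ε = δ/(2 log n)`, `t = 3(2 + δ/2)/ε` this is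
  `x (A₁ ε^δ s^δ e^{-δ s/2} + (A₂'/ε) e^{-s}/s) = o(x)` (`hooley_polyRoots_equidistributed_holds`).

## References

* C. Hooley, *On the distribution of the roots of polynomial congruences*, Mathematika 11 (1964),
  39–49. [cite: Hooley1964, main theorem and Lemmas 1, 4–8] (not held; architecture per the next
  two items).
* G. Martin, S. Sitar, *Erdős–Turán with a moving target, equidistribution of roots of reducible
  quadratics, and Diophantine quadruples*, Mathematika 57 (2011), §3.2. [cite: MartinSitar2010, §3.2]
* C. Dartyge, G. Martin, *Exponential sums with reducible polynomials*, Discrete Analysis 2019:15,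
  Lemma 5. [cite: DartygeMartin2019, Lemma 5]
* G. H. Hardy, E. M. Wright, *An Introduction to the Theory of Numbers*, 6th ed., Thm 122
  (multiplicativity of the root count). [cite: HardyWright2008, Thm 122 (§8.2)]
* H. L. Montgomery, R. C. Vaughan, *Multiplicative Number Theory I*, §7.1 eq. (7.17) (Rankin's
  method, PDF p. 160 of the held copy). [cite: MontgomeryVaughan2007, §7.1 eq. (7.17)]
-/

noncomputable section

namespace Literature.NumberTheory.Sieve

open scoped BigOperators
open Finset Polynomial

/-! ### Hooley's Lemma 4: `ρ_f(k) ≤ C_f (deg f)^{ω(k)}` -/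

/-- `ρ_f(1) = 1`. [folklore] -/
theorem polyRootCountMod_one (f : ℤ[X]) : polyRootCountMod ![f] 1 = 1 := by
  simp [polyRootCountMod]

/-- `ρ_f(0) = 0` (empty range). [folklore] -/
theorem polyRootCountMod_zero (f : ℤ[X]) : polyRootCountMod ![f] 0 = 0 := by
  simp [polyRootCountMod]

/-- **Hardy–Wright, Theorem 122**: `ρ_f` is multiplicative, so `ρ_f(k) = ∏_{p^a ∥ k} ρ_f(p^a)`
for `k ≥ 1` (Chinese remainder theorem, `polyRootCountMod_mul_of_coprime`, through Mathlib's
`ArithmeticFunction.IsMultiplicative.multiplicative_factorization` applied to the arithmetic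
function `k ↦ ρ_f(k)`). [cite: HardyWright2008, Thm 122 (§8.2)] -/
theorem polyRootCountMod_eq_prod_primeFactors (f : ℤ[X]) {k : ℕ} (hk : k ≠ 0) :
    polyRootCountMod ![f] k =
      ∏ p ∈ k.primeFactors, polyRootCountMod ![f] (p ^ k.factorization p) := by
  let ρ : ArithmeticFunction ℕ := ⟨fun k => polyRootCountMod ![f] k, by simp [polyRootCountMod]⟩
  have hρ : ∀ k, ρ k = polyRootCountMod ![f] k := fun k => rfl
  have hmult : ρ.IsMultiplicative :=
    ⟨polyRootCountMod_one f, fun hc => polyRootCountMod_mul_of_coprime f hc⟩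
  have := hmult.multiplicative_factorization ρ hk
  rw [hρ] at this
  rw [this, Finsupp.prod, Nat.support_factorization]
  rfl

/-- From prime-power bounds to `ρ_f(k) ≤ B^{ω(E)} n^{ω(k)}`: if `ρ_f(p^a) ≤ n` for the primes
`p ∤ E` (`a ≥ 1`) and `ρ_f(p^a) ≤ n B` for all primes, then `ρ_f(k) ≤ B^{ω(E)} n^{ω(k)}` for every
`k` (`ω(k) = #k.primeFactors`). [folklore] -/
theorem polyRootCountMod_le_of_prime_pow_bounds (f : ℤ[X]) {n B E : ℕ} (hE : E ≠ 0)
    (hB : 1 ≤ B)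
    (hgood : ∀ p : ℕ, p.Prime → ¬ p ∣ E → ∀ a : ℕ, 1 ≤ a → polyRootCountMod ![f] (p ^ a) ≤ n)
    (hbad : ∀ p : ℕ, p.Prime → ∀ a : ℕ, polyRootCountMod ![f] (p ^ a) ≤ n * B) (k : ℕ) :
    polyRootCountMod ![f] k ≤ B ^ E.primeFactors.card * n ^ k.primeFactors.card := by
  rcases eq_or_ne k 0 with rfl | hk
  · simp [polyRootCountMod]
  rw [polyRootCountMod_eq_prod_primeFactors f hk]
  calc ∏ p ∈ k.primeFactors, polyRootCountMod ![f] (p ^ k.factorization p)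
      ≤ ∏ p ∈ k.primeFactors, (n * if p ∣ E then B else 1) := by
        refine Finset.prod_le_prod (fun p _ => Nat.zero_le _) fun p hp => ?_
        have hpp : p.Prime := Nat.prime_of_mem_primeFactors hp
        split_ifs with hpE
        · exact hbad p hpp _
        · rw [mul_one]
          refine hgood p hpp hpE _ ?_
          exact Nat.one_le_iff_ne_zero.2
            (Finsupp.mem_support_iff.1 (by rwa [Nat.support_factorization]))
    _ = n ^ k.primeFactors.card * ∏ p ∈ k.primeFactors, (if p ∣ E then B else 1) := by
        rw [pow_card_mul_prod]
    _ ≤ n ^ k.primeFactors.card * B ^ E.primeFactors.card := by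
        refine Nat.mul_le_mul_left _ ?_
        rw [Finset.prod_ite, Finset.prod_const_one, mul_one, Finset.prod_const]
        refine Nat.pow_le_pow_right hB (Finset.card_le_card fun p hp => ?_)
        rw [mem_filter] at hp
        exact Nat.mem_primeFactors.2 ⟨Nat.prime_of_mem_primeFactors hp.1, hp.2, hE⟩
    _ = B ^ E.primeFactors.card * n ^ k.primeFactors.card := Nat.mul_comm _ _

/-- **Hooley's Lemma 4 (the bound `ρ_f(k) ≤ C n^{ω(k)}`).**  For `f ∈ ℤ[X]` irreducible of
positive degree `n` there is `C = C(f) ≥ 1` with `ρ_f(k) ≤ C · n^{ω(k)}` for every `k`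
(`ω(k)` the number of distinct prime factors; from multiplicativity, Hensel's count at the good
primes and the Nagell-type bound at all primes).
[cite: Hooley1964, Lemma 4 (per MartinSitar2010 §3.2; cf. arXiv:2003.13100 Lemma 3.4 = [5, Lemma 4]: "r(n) ≤ C·deg^{ω(n)}")] -/
theorem exists_polyRootCountMod_le_mul_pow_card_primeFactors {f : ℤ[X]} (hirr : Irreducible f)
    (hdeg : 0 < f.natDegree) :
    ∃ C : ℕ, 1 ≤ C ∧ ∀ k : ℕ,
      polyRootCountMod ![f] k ≤ C * f.natDegree ^ k.primeFactors.card := by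
  obtain ⟨E, hE, hgood⟩ := exists_forall_prime_polyRootCountMod_pow_eq hirr hdeg
  obtain ⟨M, hM, hbad⟩ := exists_polyRootCountMod_prime_pow_le hirr hdeg
  refine ⟨M ^ E.primeFactors.card, Nat.one_le_pow _ _ hM, fun k => ?_⟩
  refine polyRootCountMod_le_of_prime_pow_bounds f hE hM (fun p hp hpE a ha => ?_) hbad k
  obtain ⟨h1, h2⟩ := hgood p hp hpE a ha
  exact h1.le.trans h2

/-- **`ρ_f` on rough numbers**: with `C` as in Hooley's Lemma 4, if all prime factors of
`b ≠ 0` are `≥ z > 1` and `b ≤ x`, then `ρ_f(b) ≤ C · n^{log x / log z}` (because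
`ω(b) ≤ log b / log z`).  This crude form of Hooley's use of Lemma 4 costs a factor
`n^{log x/log z}` and is the reason for the choice `log x / log z ≍ log log x` below. [folklore] -/
theorem polyRootCountMod_le_of_rough {f : ℤ[X]} {C : ℕ}
    (hC : ∀ k : ℕ, polyRootCountMod ![f] k ≤ C * f.natDegree ^ k.primeFactors.card)
    (hn : 1 ≤ f.natDegree) {z : ℝ} (hz : 1 < z) {x b : ℕ} (hb : b ≠ 0) (hbx : b ≤ x)
    (hrough : ∀ p ∈ b.primeFactors, z ≤ (p : ℝ)) :
    (polyRootCountMod ![f] b : ℝ) ≤ C * (f.natDegree : ℝ) ^ (Real.log x / Real.log z) := by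
  have hlogz : 0 < Real.log z := Real.log_pos hz
  have hn' : (1 : ℝ) ≤ f.natDegree := by exact_mod_cast hn
  have h1 : (polyRootCountMod ![f] b : ℝ) ≤ C * (f.natDegree : ℝ) ^ (b.primeFactors.card : ℝ) := by
    rw [Real.rpow_natCast]
    exact_mod_cast hC b
  refine h1.trans (mul_le_mul_of_nonneg_left ?_ (Nat.cast_nonneg C))
  refine Real.rpow_le_rpow_of_exponent_le hn' ?_
  rw [le_div_iff₀ hlogz]
  refine (card_primeFactors_mul_log_le (by linarith) hb hrough).trans ?_
  have hb0 : (0 : ℝ) < b := by exact_mod_cast Nat.pos_of_ne_zero hb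
  exact Real.log_le_log hb0 (by exact_mod_cast hbx)

/-! ### Prime sums for `ρ_f` below `z` -/

section PrimeSums

variable {f : ℤ[X]}

/-- The primes `< ⌈z⌉₊` are the primes `≤ ⌈z⌉₊ - 1`, and `2 ≤ ⌈z⌉₊ - 1 ≤ z` for `z ≥ 3`.
[folklore] -/
theorem primesBelow_ceil_eq {z : ℝ} (hz : 3 ≤ z) :
    Nat.primesBelow ⌈z⌉₊ = Nat.primesLE (⌈z⌉₊ - 1) ∧ 2 ≤ ⌈z⌉₊ - 1 ∧ ((⌈z⌉₊ - 1 : ℕ) : ℝ) ≤ z := by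
  refine ⟨Nat.primesBelow_eq_primesLE_sub_one _, ?_, ?_⟩
  · have h3 : (3 : ℕ) ≤ ⌈z⌉₊ := by
      have : ((3 : ℕ) : ℝ) ≤ (⌈z⌉₊ : ℝ) := le_trans (by exact_mod_cast hz) (Nat.le_ceil z)
      exact_mod_cast this
    omega
  · have h1 : (⌈z⌉₊ : ℝ) < z + 1 := Nat.ceil_lt_add_one (by linarith)
    have h2 : 1 ≤ ⌈z⌉₊ := Nat.one_le_iff_ne_zero.2 (Nat.ceil_pos.2 (by linarith)).ne'
    push_cast [Nat.cast_sub h2]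
    linarith

/-- `∑_{p < ⌈z⌉₊} 1/p^s ≤ ∑_{m ≥ 0} m^{-s}` for `s > 1` (a finite constant). [folklore] -/
theorem sum_primesBelow_rpow_neg_le {s : ℝ} (hs : 1 < s) (N : ℕ) :
    ∑ p ∈ Nat.primesBelow N, (p : ℝ) ^ (-s) ≤ ∑' m : ℕ, (m : ℝ) ^ (-s) := by
  have hsum : Summable fun m : ℕ => (m : ℝ) ^ (-s) := Real.summable_nat_rpow.2 (by linarith)
  calc ∑ p ∈ Nat.primesBelow N, (p : ℝ) ^ (-s)
      ≤ ∑ m ∈ Finset.range N, (m : ℝ) ^ (-s) :=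
        Finset.sum_le_sum_of_subset_of_nonneg (Finset.filter_subset _ _)
          (fun m _ _ => by positivity)
    _ ≤ ∑' m : ℕ, (m : ℝ) ^ (-s) := hsum.sum_le_tsum _ (fun m _ => by positivity)

/-- **Mertens for `ρ_f` below `z`**: with `C₁` from `exists_sum_primesLE_rootCount_div_le`,
`∑_{p < ⌈z⌉₊} ρ_f(p)/p ≤ log log z + C₁` for `z ≥ 3`. [folklore] -/
theorem sum_primesBelow_rootCount_div_le {C₁ : ℝ}
    (hC₁ : ∀ x : ℕ, 2 ≤ x →
      ∑ p ∈ Nat.primesLE x, (polyRootCountMod ![f] p : ℝ) / p ≤ Real.log (Real.log x) + C₁)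
    {z : ℝ} (hz : 3 ≤ z) :
    ∑ p ∈ Nat.primesBelow ⌈z⌉₊, (polyRootCountMod ![f] p : ℝ) / p ≤ Real.log (Real.log z) + C₁ := by
  obtain ⟨heq, h2, hle⟩ := primesBelow_ceil_eq hz
  rw [heq]
  refine (hC₁ _ h2).trans ?_
  have h2' : (2 : ℝ) ≤ ((⌈z⌉₊ - 1 : ℕ) : ℝ) := by exact_mod_cast h2
  have := Real.log_le_log (Real.log_pos (by linarith)) (Real.log_le_log (by linarith) hle)
  linarith

/-- **Chebyshev–Mertens for `ρ_f` below `z`**: if `ρ_f(p) ≤ W` for all primes then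
`∑_{p < ⌈z⌉₊} ρ_f(p) log p / p ≤ W (log z + log 4)` (`MertensBound.sum_log_div_prime_le`).
[folklore] -/
theorem sum_primesBelow_rootCount_mul_log_div_le {W : ℝ} (hW0 : 0 ≤ W)
    (hW : ∀ p : ℕ, p.Prime → (polyRootCountMod ![f] p : ℝ) ≤ W) {z : ℝ} (hz : 3 ≤ z) :
    ∑ p ∈ Nat.primesBelow ⌈z⌉₊, (polyRootCountMod ![f] p : ℝ) * Real.log p / p ≤
      W * (Real.log z + Real.log 4) := by
  obtain ⟨heq, h2, hle⟩ := primesBelow_ceil_eq hz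
  rw [heq]
  have h2' : (2 : ℝ) ≤ ((⌈z⌉₊ - 1 : ℕ) : ℝ) := by exact_mod_cast h2
  calc ∑ p ∈ Nat.primesLE (⌈z⌉₊ - 1), (polyRootCountMod ![f] p : ℝ) * Real.log p / p
      ≤ ∑ p ∈ Nat.primesLE (⌈z⌉₊ - 1), W * (Real.log p / p) := by
        refine Finset.sum_le_sum fun p hp => ?_
        have hpp := (Nat.mem_primesLE.1 hp).2
        have hlp : 0 ≤ Real.log p / p :=
          div_nonneg (Real.log_nonneg (by exact_mod_cast hpp.one_lt.le)) (Nat.cast_nonneg p)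
        rw [mul_div_assoc]
        exact mul_le_mul_of_nonneg_right (hW p hpp) hlp
    _ = W * ∑ p ∈ Nat.primesLE (⌈z⌉₊ - 1), Real.log p / p := by rw [Finset.mul_sum]
    _ ≤ W * (Real.log ((⌈z⌉₊ - 1 : ℕ) : ℝ) + Real.log 4) :=
        mul_le_mul_of_nonneg_left (LFunctions.MertensBound.sum_log_div_prime_le _) hW0
    _ ≤ W * (Real.log z + Real.log 4) := by
        gcongr

end PrimeSums

/-! ### Hooley's Lemma 7 for `ρ_f`: Rankin's bound for the smooth moduli -/

/-- `e^s - 1 ≤ s e^s` (i.e. `1 - s ≤ e^{-s}`). [folklore] -/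
theorem exp_sub_one_le_mul_exp (s : ℝ) : Real.exp s - 1 ≤ s * Real.exp s := by
  have h := Real.add_one_le_exp (-s)
  have hpos := Real.exp_pos s
  have : Real.exp (-s) * Real.exp s = 1 := by rw [← Real.exp_add]; simp
  nlinarith

/-- **Rankin's bound for the `ρ_f`-weighted smooth moduli (Hooley's Lemma 7 with Lemma 5).**
For `f ∈ ℤ[X]` irreducible of positive degree there are `C > 0` and `B ≥ 0` such that for all
real `z ≥ 3`, all `t ≥ 0` with `3t ≤ log z`, every finite set `S` of `⌈z⌉₊`-smooth numbers and
every `w > 0`,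
`∑_{k ∈ S, k > w} ρ_f(k)/k ≤ C · e^{B t e^t} · log z · w^{-t/log z}`.
Proof: `sum_div_le_rankin` with `η = t/log z ≤ 1/3`, `g = ρ_f` (multiplicative,
`ρ_f(p^a) ≤ nM`), and `∑_{p<z} ρ_f(p) p^{η-1} ≤ ∑_{p<z} ρ_f(p)/p + η e^t ∑_{p<z} ρ_f(p) log p/p
≤ log log z + O_f(1 + t e^t)` (`p^η - 1 ≤ η log p · p^η ≤ η log p · e^t` for `p < z`; Mertens for
`ρ_f` and `∑_{p ≤ y} log p/p ≤ log y + log 4`), `∑_p p^{2η-2} ≤ ∑_m m^{-4/3}`.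
In Hooley's argument this bounds the contribution `Σ₂` of the moduli `k ≤ x` whose smooth part
exceeds `x^{1/3}`. [cite: Hooley1964, Lemmas 5 and 7 (per MartinSitar2010 §3.2)];
[cite: MontgomeryVaughan2007, §7.1 eq. (7.17) ("Rankin's method")] -/
theorem exists_sum_smooth_rootCount_div_le {f : ℤ[X]} (hirr : Irreducible f)
    (hdeg : 0 < f.natDegree) :
    ∃ C B : ℝ, 0 < C ∧ 0 ≤ B ∧ ∀ z : ℝ, 3 ≤ z → ∀ t : ℝ, 0 ≤ t → 3 * t ≤ Real.log z →
      ∀ S : Finset ℕ, (∀ k ∈ S, k ∈ Nat.smoothNumbers ⌈z⌉₊) → ∀ w : ℝ, 0 < w →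
        ∑ k ∈ S.filter (fun k : ℕ => w < (k : ℝ)), (polyRootCountMod ![f] k : ℝ) / k ≤
          C * Real.exp (B * t * Real.exp t) * Real.log z * w ^ (-(t / Real.log z)) := by
  obtain ⟨C₁, hC₁⟩ := exists_sum_primesLE_rootCount_div_le hirr hdeg
  obtain ⟨M, hM, hpow⟩ := exists_polyRootCountMod_prime_pow_le hirr hdeg
  set W : ℝ := ((f.natDegree * M : ℕ) : ℝ) with hWdef
  have hW0 : 0 ≤ W := by rw [hWdef]; positivity
  have hρW : ∀ p a : ℕ, p.Prime → 1 ≤ a → (polyRootCountMod ![f] (p ^ a) : ℝ) ≤ W := by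
    intro p a hp _
    rw [hWdef]
    exact_mod_cast hpow p hp a
  have hρW1 : ∀ p : ℕ, p.Prime → (polyRootCountMod ![f] p : ℝ) ≤ W := by
    intro p hp
    have := hρW p 1 hp le_rfl
    rwa [pow_one] at this
  set Z : ℝ := ∑' m : ℕ, (m : ℝ) ^ (-(4 / 3 : ℝ)) with hZ
  have hZ0 : 0 ≤ Z := tsum_nonneg fun m => by positivity
  refine ⟨Real.exp (C₁ + 4 * W * Z), 3 * W, Real.exp_pos _, by positivity,
    fun z hz t ht htz S hS w hw => ?_⟩
  have hz1 : 1 < z := by linarith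
  have hlogz : 0 < Real.log z := Real.log_pos hz1
  have hlogz1 : 1 < Real.log z := by
    rw [Real.lt_log_iff_exp_lt (by linarith)]
    exact Real.exp_one_lt_three.trans_le hz
  set η : ℝ := t / Real.log z with hη
  have hη0 : 0 ≤ η := div_nonneg ht hlogz.le
  have hη3 : η ≤ 1 / 3 := by
    rw [hη, div_le_iff₀ hlogz]; linarith
  have hηt : η * Real.log z = t := by rw [hη]; field_simp
  -- Rankin
  have hg0 : ∀ k, (0 : ℝ) ≤ (polyRootCountMod ![f] k : ℝ) := fun k => Nat.cast_nonneg _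
  have hg1 : ((polyRootCountMod ![f] 1 : ℕ) : ℝ) = 1 := by rw [polyRootCountMod_one]; simp
  have hmul : ∀ {m n : ℕ}, Nat.Coprime m n →
      ((polyRootCountMod ![f] (m * n) : ℕ) : ℝ) = polyRootCountMod ![f] m * polyRootCountMod ![f] n := by
    intro m n hmn
    rw [polyRootCountMod_mul_of_coprime f hmn, Nat.cast_mul]
  have hR := sum_div_le_rankin (g := fun k => (polyRootCountMod ![f] k : ℝ)) hg0 hg1 hmul hW0
    hρW ⌈z⌉₊ hη0 hη3 hw hS
  refine hR.trans ?_
  -- bound the exponent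
  have hexp_bd : ∑ p ∈ Nat.primesBelow ⌈z⌉₊,
      ((polyRootCountMod ![f] p : ℝ) * (p : ℝ) ^ (η - 1) + 4 * W * (p : ℝ) ^ (2 * η - 2)) ≤
      Real.log (Real.log z) + C₁ + 3 * W * t * Real.exp t + 4 * W * Z := by
    rw [Finset.sum_add_distrib]
    have hA : ∑ p ∈ Nat.primesBelow ⌈z⌉₊, (polyRootCountMod ![f] p : ℝ) * (p : ℝ) ^ (η - 1) ≤
        Real.log (Real.log z) + C₁ + 3 * W * t * Real.exp t := by
      -- `ρ(p) p^{η-1} ≤ ρ(p)/p + (t e^t / log z) W log p / p`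
      have hterm : ∀ p ∈ Nat.primesBelow ⌈z⌉₊,
          (polyRootCountMod ![f] p : ℝ) * (p : ℝ) ^ (η - 1) ≤
            (polyRootCountMod ![f] p : ℝ) / p +
              (t * Real.exp t / Real.log z) * ((polyRootCountMod ![f] p : ℝ) * Real.log p / p) := by
        intro p hp
        obtain ⟨hpz, hpp⟩ := Nat.mem_primesBelow.1 hp
        have hp0 : (0 : ℝ) < p := by exact_mod_cast hpp.pos
        have hp1 : (1 : ℝ) ≤ p := by exact_mod_cast hpp.one_lt.le
        have hpz' : (p : ℝ) ≤ z := by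
          have : (p : ℝ) < z := Nat.lt_ceil.1 hpz
          exact this.le
        have hlogp0 : 0 ≤ Real.log p := Real.log_nonneg hp1
        have hlogp : Real.log p ≤ Real.log z := Real.log_le_log hp0 hpz'
        -- `p^{η-1} = p^η / p`
        have e1 : (p : ℝ) ^ (η - 1) = (p : ℝ) ^ η / p := by
          rw [Real.rpow_sub hp0, Real.rpow_one]
        -- `p^η - 1 ≤ η log p · p^η ≤ (t/log z) log p e^t`
        have hs : 0 ≤ η * Real.log p := mul_nonneg hη0 hlogp0
        have e2 : (p : ℝ) ^ η = Real.exp (η * Real.log p) := by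
          rw [Real.rpow_def_of_pos hp0, mul_comm]
        have hpη : (p : ℝ) ^ η ≤ Real.exp t := by
          rw [e2, Real.exp_le_exp, ← hηt]
          exact mul_le_mul_of_nonneg_left hlogp hη0
        have h3 : (p : ℝ) ^ η - 1 ≤ (t * Real.exp t / Real.log z) * Real.log p := by
          calc (p : ℝ) ^ η - 1 ≤ (η * Real.log p) * (p : ℝ) ^ η := by
                rw [e2]; exact exp_sub_one_le_mul_exp _
            _ ≤ (η * Real.log p) * Real.exp t := mul_le_mul_of_nonneg_left hpη hs
            _ = (t * Real.exp t / Real.log z) * Real.log p := by rw [hη]; ring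
        have hρ0 : (0 : ℝ) ≤ polyRootCountMod ![f] p := Nat.cast_nonneg _
        calc (polyRootCountMod ![f] p : ℝ) * (p : ℝ) ^ (η - 1)
            = (polyRootCountMod ![f] p : ℝ) / p +
                (polyRootCountMod ![f] p : ℝ) / p * ((p : ℝ) ^ η - 1) := by rw [e1]; ring
          _ ≤ (polyRootCountMod ![f] p : ℝ) / p +
                (polyRootCountMod ![f] p : ℝ) / p * ((t * Real.exp t / Real.log z) * Real.log p) := by
              gcongr
          _ = _ := by ring
      calc ∑ p ∈ Nat.primesBelow ⌈z⌉₊, (polyRootCountMod ![f] p : ℝ) * (p : ℝ) ^ (η - 1)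
          ≤ ∑ p ∈ Nat.primesBelow ⌈z⌉₊, ((polyRootCountMod ![f] p : ℝ) / p +
              (t * Real.exp t / Real.log z) * ((polyRootCountMod ![f] p : ℝ) * Real.log p / p)) :=
            Finset.sum_le_sum hterm
        _ = ∑ p ∈ Nat.primesBelow ⌈z⌉₊, (polyRootCountMod ![f] p : ℝ) / p +
              (t * Real.exp t / Real.log z) *
                ∑ p ∈ Nat.primesBelow ⌈z⌉₊, (polyRootCountMod ![f] p : ℝ) * Real.log p / p := by
            rw [Finset.sum_add_distrib, Finset.mul_sum]
        _ ≤ (Real.log (Real.log z) + C₁) +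
              (t * Real.exp t / Real.log z) * (W * (Real.log z + Real.log 4)) := by
            gcongr
            · exact sum_primesBelow_rootCount_div_le hC₁ hz
            · exact sum_primesBelow_rootCount_mul_log_div_le hW0 hρW1 hz
        _ ≤ Real.log (Real.log z) + C₁ + 3 * W * t * Real.exp t := by
            have hlog4 : Real.log 4 ≤ 2 * Real.log z := by
              have : Real.log 4 ≤ 2 := by
                rw [show (4 : ℝ) = 2 ^ 2 by norm_num, Real.log_pow]
                have := Real.log_two_lt_d9; norm_num at this ⊢; linarith
              linarith
            have hq : (Real.log z + Real.log 4) / Real.log z ≤ 3 := by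
              rw [div_le_iff₀ hlogz]; linarith
            have hte : 0 ≤ t * Real.exp t := mul_nonneg ht (Real.exp_pos t).le
            have : (t * Real.exp t / Real.log z) * (W * (Real.log z + Real.log 4)) =
                (t * Real.exp t) * W * ((Real.log z + Real.log 4) / Real.log z) := by
              field_simp
            rw [this]
            nlinarith [mul_nonneg hte hW0]
    have hB : ∑ p ∈ Nat.primesBelow ⌈z⌉₊, 4 * W * (p : ℝ) ^ (2 * η - 2) ≤ 4 * W * Z := by
      rw [← Finset.mul_sum]
      refine mul_le_mul_of_nonneg_left ?_ (by positivity)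
      refine le_trans (Finset.sum_le_sum fun p hp => ?_) (sum_primesBelow_rpow_neg_le
        (by norm_num : (1 : ℝ) < 4 / 3) ⌈z⌉₊)
      have hp1 : (1 : ℝ) ≤ p := by exact_mod_cast (Nat.mem_primesBelow.1 hp).2.one_lt.le
      exact Real.rpow_le_rpow_of_exponent_le hp1 (by linarith)
    linarith
  -- put together
  have hw' : 0 ≤ w ^ (-η) := by positivity
  calc w ^ (-η) * Real.exp (∑ p ∈ Nat.primesBelow ⌈z⌉₊,
        ((polyRootCountMod ![f] p : ℝ) * (p : ℝ) ^ (η - 1) + 4 * W * (p : ℝ) ^ (2 * η - 2)))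
      ≤ w ^ (-η) * Real.exp (Real.log (Real.log z) + C₁ + 3 * W * t * Real.exp t + 4 * W * Z) :=
        mul_le_mul_of_nonneg_left (Real.exp_le_exp.2 hexp_bd) hw'
    _ = Real.exp (C₁ + 4 * W * Z) * Real.exp (3 * W * t * Real.exp t) * Real.log z * w ^ (-η) := by
        rw [show Real.log (Real.log z) + C₁ + 3 * W * t * Real.exp t + 4 * W * Z =
          Real.log (Real.log z) + ((C₁ + 4 * W * Z) + 3 * W * t * Real.exp t) by ring,
          Real.exp_add, Real.exp_add, Real.exp_log hlogz]
        ring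

/-! ### The saving `n - √n` at the split primes: the smooth `k₁`-sum of `√(ρ_f(k₁) k₁/φ(k₁))/k₁` -/

/-- `√r ≤ r - (n - √n) · 1_{r = n}` for natural numbers `r, n`. [folklore] -/
theorem sqrt_natCast_le_sub_indicator (r n : ℕ) :
    Real.sqrt r ≤ (r : ℝ) - ((n : ℝ) - Real.sqrt n) * (if r = n then 1 else 0) := by
  split_ifs with h
  · subst h; ring_nf; exact le_rfl
  · rw [mul_zero, sub_zero]
    rcases Nat.eq_zero_or_pos r with rfl | hr
    · simp
    · have hr1 : (1 : ℝ) ≤ r := by exact_mod_cast hr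
      rw [Real.sqrt_le_left (by linarith)]
      nlinarith

/-- `p^a / φ(p^a) ≤ 2` for a prime power (`a ≥ 1`), in the form `p^a ≤ 2 φ(p^a)`. [folklore] -/
theorem prime_pow_le_two_mul_totient {p : ℕ} (hp : p.Prime) {a : ℕ} (ha : 0 < a) :
    (p ^ a : ℝ) ≤ 2 * Nat.totient (p ^ a) := by
  rw [Nat.totient_prime_pow hp ha]
  have h2 : 2 ≤ p := hp.two_le
  have hp1 : (p : ℝ) ≤ 2 * ((p - 1 : ℕ) : ℝ) := by
    rw [Nat.cast_sub (by omega)]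
    push_cast
    have : (2 : ℝ) ≤ p := by exact_mod_cast h2
    linarith
  have : (p ^ a : ℝ) = (p : ℝ) ^ (a - 1) * p := by
    rw [← pow_succ, Nat.sub_add_cancel ha]
  rw [this]
  push_cast
  have hpa : (0 : ℝ) ≤ (p : ℝ) ^ (a - 1) := by positivity
  nlinarith

/-- **The smooth sum with the square-root weight (the source of Hooley's exponent).**
For `f ∈ ℤ[X]` irreducible of positive degree `n` there are `δ ∈ (0, 1/2]` and `C > 0` such
that for every real `z ≥ 4` and every finite set `S` of `⌈z⌉₊`-smooth numbers,
`∑_{k ∈ S} √(ρ_f(k) k / φ(k)) / k ≤ C (log z)^{1 - δ}`.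
Proof: the weight is multiplicative and bounded on prime powers, so the sum is at most
`exp(∑_{p < z} √ρ_f(p)/p + O(1))` (`sum_div_le_exp_of_smooth`); and
`√ρ_f(p) ≤ ρ_f(p) − (n − √n) 1_{ρ_f(p) = n}` with `∑_{p < z} ρ_f(p)/p ≤ log log z + O(1)`
(Mertens for `ρ_f`) and `∑_{p < z, ρ_f(p) = n} 1/p ≥ c log log z − O(1)` (the split primes,
`exists_loglog_le_sum_inv_primes_rootCount_eq_natDegree`), so the exponent is
`≤ (1 − c(n − √n)) log log z + O(1)`; `δ = min(c(n − √n), 1/2)`.  With `c ≥ 1/n!` this is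
Hooley's `δ_n = (n − √n)/n!` (`Literature.NumberTheory.Sieve.hooleyDelta`); only `δ > 0` is retained here.
[cite: Hooley1964, main theorem, the exponent (n − √n)/n! (per DartygeMartin2019 Lemma 5)];
[cite: MartinSitar2010, §3.2 ("Σ₁ ≪ ∑_{k₁ ≤ x^{1/3}} (Σ₅ Σ₆)^{1/2}")] -/
theorem exists_sum_smooth_sqrt_rootCount_div_le {f : ℤ[X]} (hirr : Irreducible f)
    (hdeg : 2 ≤ f.natDegree) :
    ∃ δ : ℝ, 0 < δ ∧ δ ≤ 1 / 2 ∧ ∃ C : ℝ, 0 < C ∧ ∀ z : ℝ, 4 ≤ z →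
      ∀ S : Finset ℕ, (∀ k ∈ S, k ∈ Nat.smoothNumbers ⌈z⌉₊) →
        ∑ k ∈ S, Real.sqrt ((polyRootCountMod ![f] k : ℝ) * k / Nat.totient k) / k ≤
          C * Real.log z ^ (1 - δ) := by
  have hdeg0 : 0 < f.natDegree := by omega
  set n : ℕ := f.natDegree with hn
  obtain ⟨C₁, hC₁⟩ := exists_sum_primesLE_rootCount_div_le hirr hdeg0
  obtain ⟨c, hc, C₂, hC₂⟩ := exists_loglog_le_sum_inv_primes_rootCount_eq_natDegree hirr hdeg0
  obtain ⟨M, hM, hpow⟩ := exists_polyRootCountMod_prime_pow_le hirr hdeg0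
  set W : ℝ := ((f.natDegree * M : ℕ) : ℝ) with hWdef
  have hW0 : 0 ≤ W := by rw [hWdef]; positivity
  have hρW : ∀ p a : ℕ, p.Prime → (polyRootCountMod ![f] (p ^ a) : ℝ) ≤ W := by
    intro p a hp
    rw [hWdef]
    exact_mod_cast hpow p hp a
  -- the saving
  have hnn : 0 < (n : ℝ) - Real.sqrt n := by
    have hn2 : (2 : ℝ) ≤ n := by rw [hn]; exact_mod_cast hdeg
    rw [sub_pos, Real.sqrt_lt' (by linarith)]
    nlinarith
  set δ₀ : ℝ := c * ((n : ℝ) - Real.sqrt n) with hδ₀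
  have hδ₀pos : 0 < δ₀ := mul_pos hc hnn
  set δ : ℝ := min δ₀ (1 / 2) with hδ
  have hδpos : 0 < δ := lt_min hδ₀pos one_half_pos
  have hδle : δ ≤ 1 / 2 := min_le_right _ _
  have hδle' : δ ≤ δ₀ := min_le_left _ _
  -- constants
  set W' : ℝ := Real.sqrt (2 * W) with hW'
  have hW'0 : 0 ≤ W' := Real.sqrt_nonneg _
  set Z : ℝ := ∑' m : ℕ, (m : ℝ) ^ (-(2 : ℝ)) with hZ
  have hZ0 : 0 ≤ Z := tsum_nonneg fun m => by positivity
  set C₃ : ℝ := C₁ + ((n : ℝ) - Real.sqrt n) * C₂ with hC₃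
  set C₄ : ℝ := C₃ + (2 * Real.sqrt W + 4 * W') * Z with hC₄
  refine ⟨δ, hδpos, hδle, Real.exp C₄, Real.exp_pos _, fun z hz S hS => ?_⟩
  have hz1 : 1 < z := by linarith
  have hlogz : 0 < Real.log z := Real.log_pos hz1
  -- the weight
  set g : ℕ → ℝ := fun k => Real.sqrt ((polyRootCountMod ![f] k : ℝ) * k / Nat.totient k) with hg
  have hg0 : ∀ k, 0 ≤ g k := fun k => Real.sqrt_nonneg _
  have hg1 : g 1 = 1 := by simp [hg, polyRootCountMod_one]
  have hmul : ∀ {a b : ℕ}, Nat.Coprime a b → g (a * b) = g a * g b := by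
    intro a b hab
    simp only [hg]
    rw [polyRootCountMod_mul_of_coprime f hab, Nat.totient_mul hab, ← Real.sqrt_mul
      (by positivity)]
    congr 1
    push_cast
    rcases Nat.eq_zero_or_pos a with rfl | ha
    · simp [polyRootCountMod_zero]
    rcases Nat.eq_zero_or_pos b with rfl | hb
    · simp [polyRootCountMod_zero]
    have hφa : (0 : ℝ) < Nat.totient a := by exact_mod_cast Nat.totient_pos.2 ha
    have hφb : (0 : ℝ) < Nat.totient b := by exact_mod_cast Nat.totient_pos.2 hb
    field_simp
  have hgW : ∀ p a : ℕ, p.Prime → 1 ≤ a → g (p ^ a) ≤ W' := by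
    intro p a hp ha
    simp only [hg, hW']
    refine Real.sqrt_le_sqrt ?_
    have hφ : (0 : ℝ) < Nat.totient (p ^ a) := by
      exact_mod_cast Nat.totient_pos.2 (pow_pos hp.pos a)
    rw [div_le_iff₀ hφ]
    have h1 := hρW p a hp
    have h2 := prime_pow_le_two_mul_totient hp (by omega : 0 < a)
    have hρ0 : (0 : ℝ) ≤ polyRootCountMod ![f] (p ^ a) := Nat.cast_nonneg _
    push_cast at h2 ⊢
    nlinarith
  have hmain := sum_div_le_exp_of_smooth hg0 hg1 hmul hW'0 hgW ⌈z⌉₊ hS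
  refine hmain.trans ?_
  -- bound the exponent by `(1 - δ) log log z + C₄`
  have hz3 : (3 : ℝ) ≤ z := by linarith
  obtain ⟨heq, h2, hle⟩ := primesBelow_ceil_eq hz3
  -- `N - 1 ≥ 3`, so `log log (N-1) ≥ 0`
  have hN3 : 3 ≤ ⌈z⌉₊ - 1 := by
    have : (4 : ℕ) ≤ ⌈z⌉₊ := Nat.cast_le.1 (le_trans (by push_cast; exact hz) (Nat.le_ceil z))
    omega
  set Y : ℕ := ⌈z⌉₊ - 1 with hY
  have hY3 : (3 : ℝ) ≤ Y := by exact_mod_cast hN3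
  have hLL0 : 0 ≤ Real.log (Real.log Y) := by
    refine Real.log_nonneg ?_
    rw [Real.le_log_iff_exp_le (by linarith)]
    exact Real.exp_one_lt_three.le.trans hY3
  have hLLle : Real.log (Real.log Y) ≤ Real.log (Real.log z) :=
    Real.log_le_log (Real.log_pos (by linarith)) (Real.log_le_log (by linarith) hle)
  -- `g(p)/p ≤ √ρ(p)/p + 2√W/p²`
  have hgp : ∀ p ∈ Nat.primesBelow ⌈z⌉₊,
      g p / p ≤ Real.sqrt (polyRootCountMod ![f] p) / p + 2 * Real.sqrt W * (p : ℝ) ^ (-(2 : ℝ)) := by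
    intro p hp
    have hpp := (Nat.mem_primesBelow.1 hp).2
    have hp0 : (0 : ℝ) < p := by exact_mod_cast hpp.pos
    have hp2 : (2 : ℝ) ≤ p := by exact_mod_cast hpp.two_le
    have hφ : (Nat.totient p : ℝ) = p - 1 := by
      rw [Nat.totient_prime hpp, Nat.cast_sub hpp.pos]; simp
    have hρ0 : (0 : ℝ) ≤ polyRootCountMod ![f] p := Nat.cast_nonneg _
    have hρW1 : (polyRootCountMod ![f] p : ℝ) ≤ W := by
      have := hρW p 1 hpp; rwa [pow_one] at this
    -- `g p = √ρ · √(p/(p-1)) ≤ √ρ · p/(p-1) ≤ √ρ (1 + 2/p)`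
    have hq1 : 1 ≤ (p : ℝ) / (p - 1) := by
      rw [le_div_iff₀ (by linarith)]; linarith
    have hq2 : (p : ℝ) / (p - 1) ≤ 1 + 2 / p := by
      rw [div_le_iff₀ (by linarith : (0 : ℝ) < p - 1)]
      field_simp
      nlinarith
    have hsq : Real.sqrt ((p : ℝ) / (p - 1)) ≤ (p : ℝ) / (p - 1) := by
      rw [Real.sqrt_le_left (by linarith)]
      nlinarith
    have hgp' : g p ≤ Real.sqrt (polyRootCountMod ![f] p) * (1 + 2 / p) := by
      simp only [hg]
      rw [hφ, mul_div_assoc, Real.sqrt_mul hρ0]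
      exact mul_le_mul_of_nonneg_left (hsq.trans hq2) (Real.sqrt_nonneg _)
    have hsW : Real.sqrt (polyRootCountMod ![f] p) ≤ Real.sqrt W := Real.sqrt_le_sqrt hρW1
    have e : (p : ℝ) ^ (-(2 : ℝ)) = 1 / (p : ℝ) ^ 2 := by
      rw [show (-(2 : ℝ)) = ((-2 : ℤ) : ℝ) by norm_num, Real.rpow_intCast, zpow_neg, zpow_ofNat,
        one_div]
    rw [e]
    calc g p / p ≤ Real.sqrt (polyRootCountMod ![f] p) * (1 + 2 / p) / p :=
          div_le_div_of_nonneg_right hgp' hp0.le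
      _ = Real.sqrt (polyRootCountMod ![f] p) / p +
            2 * Real.sqrt (polyRootCountMod ![f] p) * (1 / (p : ℝ) ^ 2) := by
          field_simp
      _ ≤ Real.sqrt (polyRootCountMod ![f] p) / p + 2 * Real.sqrt W * (1 / (p : ℝ) ^ 2) := by
          gcongr
  -- `∑ √ρ(p)/p ≤ (1 - δ) log log z + C₃`
  have hsqrt : ∑ p ∈ Nat.primesBelow ⌈z⌉₊, Real.sqrt (polyRootCountMod ![f] p) / p ≤
      (1 - δ) * Real.log (Real.log z) + C₃ := by
    rw [heq]
    have hup := hC₁ Y h2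
    have hlow := hC₂ Y h2
    -- pointwise
    have hpt : ∀ p ∈ Nat.primesLE Y, Real.sqrt (polyRootCountMod ![f] p) / p ≤
        (polyRootCountMod ![f] p : ℝ) / p -
          ((n : ℝ) - Real.sqrt n) * ((if polyRootCountMod ![f] p = n then (1 : ℝ) else 0) / p) := by
      intro p hp
      have hp0 : (0 : ℝ) < p := by exact_mod_cast (Nat.mem_primesLE.1 hp).2.pos
      have := sqrt_natCast_le_sub_indicator (polyRootCountMod ![f] p) n
      rw [mul_div_assoc', ← sub_div]
      exact div_le_div_of_nonneg_right this hp0.le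
    have hind : ∑ p ∈ Nat.primesLE Y, (if polyRootCountMod ![f] p = n then (1 : ℝ) else 0) / p =
        ∑ p ∈ (Nat.primesLE Y).filter (fun p => polyRootCountMod ![f] p = f.natDegree),
          (1 : ℝ) / p := by
      rw [Finset.sum_filter]
      refine Finset.sum_congr rfl fun p _ => ?_
      split_ifs <;> simp
    calc ∑ p ∈ Nat.primesLE Y, Real.sqrt (polyRootCountMod ![f] p) / p
        ≤ ∑ p ∈ Nat.primesLE Y, ((polyRootCountMod ![f] p : ℝ) / p -
            ((n : ℝ) - Real.sqrt n) * ((if polyRootCountMod ![f] p = n then (1 : ℝ) else 0) / p)) :=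
          Finset.sum_le_sum hpt
      _ = ∑ p ∈ Nat.primesLE Y, (polyRootCountMod ![f] p : ℝ) / p -
            ((n : ℝ) - Real.sqrt n) *
              ∑ p ∈ (Nat.primesLE Y).filter (fun p => polyRootCountMod ![f] p = f.natDegree),
                (1 : ℝ) / p := by
          rw [Finset.sum_sub_distrib, ← Finset.mul_sum, hind]
      _ ≤ (Real.log (Real.log Y) + C₁) -
            ((n : ℝ) - Real.sqrt n) * (c * Real.log (Real.log Y) - C₂) := by
          gcongr
      _ = (1 - δ₀) * Real.log (Real.log Y) + C₃ := by rw [hδ₀, hC₃]; ring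
      _ ≤ (1 - δ) * Real.log (Real.log Y) + C₃ := by
          have := mul_le_mul_of_nonneg_right hδle' hLL0
          linarith
      _ ≤ (1 - δ) * Real.log (Real.log z) + C₃ := by
          have := mul_le_mul_of_nonneg_left hLLle (by linarith : (0 : ℝ) ≤ 1 - δ)
          linarith
  -- the constant part
  have hconst : ∑ p ∈ Nat.primesBelow ⌈z⌉₊,
      (2 * Real.sqrt W * (p : ℝ) ^ (-(2 : ℝ)) + 4 * W' / (p : ℝ) ^ 2) ≤
        (2 * Real.sqrt W + 4 * W') * Z := by
    have e : ∀ p ∈ Nat.primesBelow ⌈z⌉₊, (2 * Real.sqrt W * (p : ℝ) ^ (-(2 : ℝ)) + 4 * W' / (p : ℝ) ^ 2)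
        = (2 * Real.sqrt W + 4 * W') * (p : ℝ) ^ (-(2 : ℝ)) := by
      intro p _
      rw [show (-(2 : ℝ)) = ((-2 : ℤ) : ℝ) by norm_num, Real.rpow_intCast, zpow_neg, zpow_ofNat]
      ring
    rw [Finset.sum_congr rfl e, ← Finset.mul_sum]
    exact mul_le_mul_of_nonneg_left (sum_primesBelow_rpow_neg_le (by norm_num) _) (by positivity)
  have hexp : ∑ p ∈ Nat.primesBelow ⌈z⌉₊, (g p / p + 4 * W' / (p : ℝ) ^ 2) ≤
      (1 - δ) * Real.log (Real.log z) + C₄ := by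
    calc ∑ p ∈ Nat.primesBelow ⌈z⌉₊, (g p / p + 4 * W' / (p : ℝ) ^ 2)
        ≤ ∑ p ∈ Nat.primesBelow ⌈z⌉₊, (Real.sqrt (polyRootCountMod ![f] p) / p +
            (2 * Real.sqrt W * (p : ℝ) ^ (-(2 : ℝ)) + 4 * W' / (p : ℝ) ^ 2)) := by
          refine Finset.sum_le_sum fun p hp => ?_
          linarith [hgp p hp]
      _ = ∑ p ∈ Nat.primesBelow ⌈z⌉₊, Real.sqrt (polyRootCountMod ![f] p) / p +
            ∑ p ∈ Nat.primesBelow ⌈z⌉₊,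
              (2 * Real.sqrt W * (p : ℝ) ^ (-(2 : ℝ)) + 4 * W' / (p : ℝ) ^ 2) :=
          Finset.sum_add_distrib
      _ ≤ ((1 - δ) * Real.log (Real.log z) + C₃) + (2 * Real.sqrt W + 4 * W') * Z :=
          add_le_add hsqrt hconst
      _ = (1 - δ) * Real.log (Real.log z) + C₄ := by rw [hC₄]; ring
  calc Real.exp (∑ p ∈ Nat.primesBelow ⌈z⌉₊, (g p / p + 4 * W' / (p : ℝ) ^ 2))
      ≤ Real.exp ((1 - δ) * Real.log (Real.log z) + C₄) := Real.exp_le_exp.2 hexp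
    _ = Real.exp C₄ * Real.log z ^ (1 - δ) := by
        rw [Real.exp_add, Real.rpow_def_of_pos hlogz, mul_comm (Real.log (Real.log z))]
        ring

end Literature.NumberTheory.Sieve

namespace Literature.NumberTheory.Sieve

open scoped BigOperators
open Finset Polynomial

/-! ### Rough numbers: the bridge between `roughIcc` and the sieve -/

section Bridge

variable {K : ℝ}

/-- **Rough numbers in a residue class to a smooth modulus** (the sieve input, restated for
`roughIcc`): `#{b ∈ roughIcc ⌈z⌉₊ t : b ≡ s (q)} ≤ K (t/(φ(q) log z) + z^{10})`. [folklore] -/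
theorem card_roughIcc_filter_modEq_le
    (hK : ∀ z : ℝ, 2 ≤ z → ∀ q : ℕ, q ∈ Nat.smoothNumbers ⌈z⌉₊ → ∀ s : ℕ, ∀ y : ℝ, 0 ≤ y →
      (#((Ioc 0 ⌊y⌋₊).filter
          (fun n : ℕ => n ≡ s [MOD q] ∧ n.Coprime (primesProdBelow z))) : ℝ) ≤
        K * (y / ((Nat.totient q : ℝ) * Real.log z) + z ^ (10 : ℕ)))
    {z : ℝ} (hz : 2 ≤ z) {q : ℕ} (hq : q ∈ Nat.smoothNumbers ⌈z⌉₊) (s t : ℕ) :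
    (#((roughIcc ⌈z⌉₊ t).filter (fun b : ℕ => b ≡ s [MOD q])) : ℝ) ≤
      K * ((t : ℝ) / ((Nat.totient q : ℝ) * Real.log z) + z ^ (10 : ℕ)) := by
  have h := hK z hz q hq s (t : ℝ) (Nat.cast_nonneg t)
  rw [Nat.floor_natCast] at h
  refine le_of_eq_of_le ?_ h
  rw [roughIcc_ceil_eq, Finset.filter_filter]
  congr 2
  ext n
  simp only [mem_filter, and_comm]

/-- **The number of rough numbers** (modulus `1`): `#roughIcc ⌈z⌉₊ t ≤ K (t/log z + z^{10})`.
[folklore] -/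
theorem card_roughIcc_le
    (hK : ∀ z : ℝ, 2 ≤ z → ∀ q : ℕ, q ∈ Nat.smoothNumbers ⌈z⌉₊ → ∀ s : ℕ, ∀ y : ℝ, 0 ≤ y →
      (#((Ioc 0 ⌊y⌋₊).filter
          (fun n : ℕ => n ≡ s [MOD q] ∧ n.Coprime (primesProdBelow z))) : ℝ) ≤
        K * (y / ((Nat.totient q : ℝ) * Real.log z) + z ^ (10 : ℕ)))
    {z : ℝ} (hz : 2 ≤ z) (t : ℕ) :
    (#(roughIcc ⌈z⌉₊ t) : ℝ) ≤ K * ((t : ℝ) / Real.log z + z ^ (10 : ℕ)) := by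
  have h1 : (1 : ℕ) ∈ Nat.smoothNumbers ⌈z⌉₊ := by
    rw [Nat.mem_smoothNumbers']
    intro p hp hp1
    exact absurd (Nat.le_of_dvd one_pos hp1) (not_le.2 hp.one_lt)
  have h := card_roughIcc_filter_modEq_le hK hz h1 0 t
  rw [Nat.totient_one, Nat.cast_one, one_mul] at h
  refine le_of_eq_of_le ?_ h
  congr 2
  rw [Finset.filter_true_of_mem fun b _ => Nat.modEq_one]

end Bridge

/-! ### Hooley's `Σ₆`: the twisted second moment over the rough cofactors -/

section Sigma6

variable (f : ℤ[X]) (h : ℤ)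

/-- The inverse of `b` modulo `a`, as a natural number `< a` (for `a ≥ 1`): `b · inv ≡ 1 (a)` when
`(b, a) = 1`. [folklore] -/
theorem natCast_mul_inv_val_modEq {a : ℕ} [NeZero a] {b : ℕ} (hb : b.Coprime a) :
    (b : ℤ) * ((((b : ZMod a)⁻¹).val : ℕ) : ℤ) ≡ 1 [ZMOD a] := by
  rw [← ZMod.intCast_eq_intCast_iff]
  push_cast
  rw [ZMod.natCast_zmod_val, ZMod.coe_mul_inv_eq_one b hb]

/-- **The first step of Hooley's `Σ₁`**: for `a ≥ 1` and a finite set `B` of numbers prime to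
`a`, `|∑_{b ∈ B} S_f(h, a b)| ≤ ∑_{b ∈ B} ρ_f(b) |S_f(h b̄, a)|` (`b b̄ ≡ 1 (a)`; Lemma 1 and the
trivial bound on the second factor). [cite: MartinSitar2010, §3.2 (outline of Hooley's Σ₁)] -/
theorem norm_sum_polyRootWeylSum_mul_le {a : ℕ} [NeZero a] (B : Finset ℕ)
    (hB : ∀ b ∈ B, b.Coprime a) :
    ‖∑ b ∈ B, polyRootWeylSum f (a * b) h‖ ≤
      ∑ b ∈ B, (polyRootCountMod ![f] b : ℝ) *
        ‖polyRootWeylSum f a (h * ((((b : ZMod a)⁻¹).val : ℕ) : ℤ))‖ := by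
  refine (norm_sum_le _ _).trans (Finset.sum_le_sum fun b hb => ?_)
  rw [mul_comm (polyRootCountMod ![f] b : ℝ)]
  exact norm_polyRootWeylSum_mul_le f (hB b hb).symm (natCast_mul_inv_val_modEq (hB b hb)) h

/-- **Hooley's `Σ₆` (the twisted second moment over the cofactors).**  Let `a ≥ 1`, `B` a finite
set of numbers prime to `a` with at most `M` elements in every residue class modulo `a`.  Then
`∑_{b ∈ B} |S_f(h b̄, a)|² ≤ M · (h, a) · a · ρ_f(a)`: group the `b` by the class of `b̄`, and use
the twisted second moment `∑_{r mod a} |S_f(h r, a)|² ≤ (h, a) a ρ_f(a)`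
(`sum_range_norm_sq_polyRootWeylSum_mul_le`, "his equation (9)").
[cite: MartinSitar2010, §3.2 ("Σ₆ … the factor (h, k₁)")]; [folklore] -/
theorem sum_norm_sq_polyRootWeylSum_inv_le {a : ℕ} [NeZero a] (B : Finset ℕ)
    (hB : ∀ b ∈ B, b.Coprime a) {M : ℝ}
    (hM : ∀ s : ℕ, (#(B.filter (fun b : ℕ => b ≡ s [MOD a])) : ℝ) ≤ M) :
    ∑ b ∈ B, ‖polyRootWeylSum f a (h * ((((b : ZMod a)⁻¹).val : ℕ) : ℤ))‖ ^ 2 ≤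
      M * ((Int.gcd h a : ℝ) * a * polyRootCountMod ![f] a) := by
  set inv : ℕ → ℕ := fun b => ((b : ZMod a)⁻¹).val with hinv
  set F : ℕ → ℝ := fun r => ‖polyRootWeylSum f a (h * (r : ℤ))‖ ^ 2 with hF
  have hmaps : ∀ b ∈ B, inv b ∈ range a := fun b _ => mem_range.2 (ZMod.val_lt _)
  have hM0 : 0 ≤ M := le_trans (Nat.cast_nonneg _) (hM 0)
  -- group by the value of `inv b`
  have hfib : ∑ b ∈ B, F (inv b) = ∑ r ∈ range a, (#(B.filter (fun b => inv b = r)) : ℝ) * F r := by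
    rw [← Finset.sum_fiberwise_of_maps_to' hmaps F]
    refine Finset.sum_congr rfl fun r _ => ?_
    rw [Finset.sum_const, nsmul_eq_mul]
  -- each fibre lies in one residue class
  have hcard : ∀ r ∈ range a, (#(B.filter (fun b => inv b = r)) : ℝ) ≤ M := by
    intro r _
    refine le_trans ?_ (hM (((r : ZMod a)⁻¹).val))
    exact_mod_cast Finset.card_le_card (Finset.monotone_filter_right _ fun b hb hbr => by
      -- `b ≡ (r⁻¹).val (mod a)`
      rw [← ZMod.natCast_eq_natCast_iff, ZMod.natCast_zmod_val]
      have h1 : (b : ZMod a) * (r : ZMod a) = 1 := by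
        rw [← hbr, hinv, ZMod.natCast_zmod_val]
        exact ZMod.coe_mul_inv_eq_one b (hB b hb)
      have hu : IsUnit (r : ZMod a) := IsUnit.of_mul_eq_one_right _ h1
      calc (b : ZMod a) = (b : ZMod a) * ((r : ZMod a) * (r : ZMod a)⁻¹) := by
            rw [ZMod.mul_inv_of_unit _ hu, mul_one]
        _ = (r : ZMod a)⁻¹ := by rw [← mul_assoc, h1, one_mul])
  have hF0 : ∀ r, 0 ≤ F r := fun r => sq_nonneg _
  calc ∑ b ∈ B, ‖polyRootWeylSum f a (h * ((inv b : ℕ) : ℤ))‖ ^ 2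
      = ∑ b ∈ B, F (inv b) := rfl
    _ = ∑ r ∈ range a, (#(B.filter (fun b => inv b = r)) : ℝ) * F r := hfib
    _ ≤ ∑ r ∈ range a, M * F r :=
        Finset.sum_le_sum fun r hr => mul_le_mul_of_nonneg_right (hcard r hr) (hF0 r)
    _ = M * ∑ r ∈ range a, F r := by rw [Finset.mul_sum]
    _ ≤ M * ((Int.gcd h a : ℝ) * a * polyRootCountMod ![f] a) :=
        mul_le_mul_of_nonneg_left (sum_range_norm_sq_polyRootWeylSum_mul_le f a h) hM0

/-- **Cauchy–Schwarz for Hooley's `Σ₁` term**: with `B`, `M` as above,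
`|∑_{b ∈ B} S_f(h, a b)|² ≤ (∑_{b ∈ B} ρ_f(b)²) · M (h, a) a ρ_f(a)` (`= Σ₅ · Σ₆`).
[cite: MartinSitar2010, §3.2 ("Σ₁ ≪ ∑_{k₁ ≤ x^{1/3}} (Σ₅ Σ₆)^{1/2}")] -/
theorem norm_sum_polyRootWeylSum_mul_sq_le {a : ℕ} [NeZero a] (B : Finset ℕ)
    (hB : ∀ b ∈ B, b.Coprime a) {M : ℝ}
    (hM : ∀ s : ℕ, (#(B.filter (fun b : ℕ => b ≡ s [MOD a])) : ℝ) ≤ M) :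
    ‖∑ b ∈ B, polyRootWeylSum f (a * b) h‖ ^ 2 ≤
      (∑ b ∈ B, (polyRootCountMod ![f] b : ℝ) ^ 2) *
        (M * ((Int.gcd h a : ℝ) * a * polyRootCountMod ![f] a)) := by
  have h1 := norm_sum_polyRootWeylSum_mul_le f h B hB
  have hcs := Finset.sum_mul_sq_le_sq_mul_sq B (fun b => (polyRootCountMod ![f] b : ℝ))
    (fun b => ‖polyRootWeylSum f a (h * ((((b : ZMod a)⁻¹).val : ℕ) : ℤ))‖)
  have h2 := sum_norm_sq_polyRootWeylSum_inv_le f h B hB hM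
  have h0 : 0 ≤ ∑ b ∈ B, (polyRootCountMod ![f] b : ℝ) ^ 2 :=
    Finset.sum_nonneg fun b _ => sq_nonneg _
  calc ‖∑ b ∈ B, polyRootWeylSum f (a * b) h‖ ^ 2
      ≤ (∑ b ∈ B, (polyRootCountMod ![f] b : ℝ) *
          ‖polyRootWeylSum f a (h * ((((b : ZMod a)⁻¹).val : ℕ) : ℤ))‖) ^ 2 :=
        pow_le_pow_left₀ (norm_nonneg _) h1 2
    _ ≤ _ := hcs
    _ ≤ _ := mul_le_mul_of_nonneg_left h2 h0

end Sigma6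

/-! ### The two halves `Σ₂` (large smooth part) and `Σ₁` (small smooth part) -/

section Core

variable (f : ℤ[X]) (h : ℤ)

/-- `#roughIcc N t ≤ t`. [folklore] -/
theorem card_roughIcc_le_self (N t : ℕ) : #(roughIcc N t) ≤ t :=
  (Finset.card_le_card (roughIcc_subset_Icc N t)).trans (by simp)

/-- **Hooley's `Σ₂`, trivially**: if `ρ_f(b) ≤ Ξ` for the rough cofactors, then
`|∑_{a smooth ≤ x, a³ > x} ∑_{b ∈ roughIcc N (x/a)} S_f(h, ab)| ≤ Ξ x ∑_{a smooth ≤ x, a³ > x} ρ_f(a)/a`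
(`|S_f(h, ab)| ≤ ρ_f(a) ρ_f(b)` and `#roughIcc N (x/a) ≤ x/a`).
[cite: MartinSitar2010, §3.2 ("Σ₂ ≪ ∑_{k ≤ x, k₁ > x^{1/3}} ρ(k)")] -/
theorem norm_sigma2_le {N x : ℕ} {Ξ : ℝ} (hΞ0 : 0 ≤ Ξ)
    (hΞ : ∀ a ∈ Nat.smoothNumbersUpTo x N, ∀ b ∈ roughIcc N (x / a),
      (polyRootCountMod ![f] b : ℝ) ≤ Ξ) :
    ‖∑ a ∈ (Nat.smoothNumbersUpTo x N).filter (fun a => x < a ^ 3),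
        ∑ b ∈ roughIcc N (x / a), polyRootWeylSum f (a * b) h‖ ≤
      Ξ * x * ∑ a ∈ (Nat.smoothNumbersUpTo x N).filter (fun a => x < a ^ 3),
        (polyRootCountMod ![f] a : ℝ) / a := by
  rw [Finset.mul_sum]
  refine (norm_sum_le _ _).trans (Finset.sum_le_sum fun a ha => ?_)
  obtain ⟨ha, -⟩ := mem_filter.1 ha
  have hsm := (Nat.mem_smoothNumbersUpTo.1 ha).2
  have ha0 : a ≠ 0 := Nat.ne_zero_of_mem_smoothNumbers hsm
  have ha0' : (0 : ℝ) < a := by exact_mod_cast Nat.pos_of_ne_zero ha0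
  have hρa : (0 : ℝ) ≤ polyRootCountMod ![f] a := Nat.cast_nonneg _
  calc ‖∑ b ∈ roughIcc N (x / a), polyRootWeylSum f (a * b) h‖
      ≤ ∑ b ∈ roughIcc N (x / a), (polyRootCountMod ![f] a : ℝ) * Ξ := by
        refine (norm_sum_le _ _).trans (Finset.sum_le_sum fun b hb => ?_)
        have hcop : a.Coprime b := coprime_of_smooth_of_mem_roughIcc hsm hb
        calc ‖polyRootWeylSum f (a * b) h‖ ≤ polyRootCountMod ![f] (a * b) :=
              norm_polyRootWeylSum_le f _ h
          _ = (polyRootCountMod ![f] a : ℝ) * polyRootCountMod ![f] b := by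
              rw [polyRootCountMod_mul_of_coprime f hcop, Nat.cast_mul]
          _ ≤ (polyRootCountMod ![f] a : ℝ) * Ξ := mul_le_mul_of_nonneg_left (hΞ a ha b hb) hρa
    _ = #(roughIcc N (x / a)) * ((polyRootCountMod ![f] a : ℝ) * Ξ) := by
        rw [Finset.sum_const, nsmul_eq_mul]
    _ ≤ ((x : ℝ) / a) * ((polyRootCountMod ![f] a : ℝ) * Ξ) := by
        refine mul_le_mul_of_nonneg_right ?_ (mul_nonneg hρa hΞ0)
        calc (#(roughIcc N (x / a)) : ℝ) ≤ ((x / a : ℕ) : ℝ) := by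
              exact_mod_cast card_roughIcc_le_self N (x / a)
          _ ≤ (x : ℝ) / a := Nat.cast_div_le
    _ = Ξ * x * ((polyRootCountMod ![f] a : ℝ) / a) := by
        field_simp

variable {K : ℝ}

/-- **Hooley's `Σ₁` term** for one smooth modulus `a ≤ x` (with `N = ⌈z⌉₊`): if `ρ_f(b) ≤ Ξ` on
`roughIcc N (x/a)`, the rough numbers in progressions obey the sieve bound with constant `K`, and
`z^{10} ≤ (x/a)/(φ(a) log z)` (so that the sieve error term is absorbed), then
`|∑_{b ∈ roughIcc N (x/a)} S_f(h, ab)| ≤ 2K √|h| Ξ · (x/a)/log z · √(ρ_f(a) a/φ(a))`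
(Cauchy–Schwarz `Σ₅ Σ₆` with `Σ₅ ≤ Ξ² · 2K (x/a)/log z` and `Σ₆ ≤ 2K (x/a)/(φ(a) log z) · |h| a ρ_f(a)`).
[cite: MartinSitar2010, §3.2 (Σ₁, Σ₅, Σ₆)] -/
theorem norm_sigma1_term_le
    (hK : ∀ z : ℝ, 2 ≤ z → ∀ q : ℕ, q ∈ Nat.smoothNumbers ⌈z⌉₊ → ∀ s : ℕ, ∀ y : ℝ, 0 ≤ y →
      (#((Ioc 0 ⌊y⌋₊).filter
          (fun n : ℕ => n ≡ s [MOD q] ∧ n.Coprime (primesProdBelow z))) : ℝ) ≤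
        K * (y / ((Nat.totient q : ℝ) * Real.log z) + z ^ (10 : ℕ)))
    (hh : h ≠ 0) {z : ℝ} (hz : 2 ≤ z) {x a : ℕ} (ha : a ∈ Nat.smoothNumbersUpTo x ⌈z⌉₊) {Ξ : ℝ}
    (hΞ0 : 0 ≤ Ξ) (hΞ : ∀ b ∈ roughIcc ⌈z⌉₊ (x / a), (polyRootCountMod ![f] b : ℝ) ≤ Ξ)
    (hcond : z ^ (10 : ℕ) ≤ ((x : ℝ) / a) / ((Nat.totient a : ℝ) * Real.log z)) :
    ‖∑ b ∈ roughIcc ⌈z⌉₊ (x / a), polyRootWeylSum f (a * b) h‖ ≤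
      2 * K * Real.sqrt (h.natAbs) * Ξ * (((x : ℝ) / a) / Real.log z) *
        Real.sqrt ((polyRootCountMod ![f] a : ℝ) * a / Nat.totient a) := by
  have hsm := (Nat.mem_smoothNumbersUpTo.1 ha).2
  have ha0 : a ≠ 0 := Nat.ne_zero_of_mem_smoothNumbers hsm
  haveI : NeZero a := ⟨ha0⟩
  have hapos : 0 < a := Nat.pos_of_ne_zero ha0
  have ha0' : (0 : ℝ) < a := by exact_mod_cast hapos
  have hφ0 : (0 : ℝ) < Nat.totient a := by exact_mod_cast Nat.totient_pos.2 hapos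
  have hφ1 : (1 : ℝ) ≤ Nat.totient a := by exact_mod_cast Nat.totient_pos.2 hapos
  have hlogz : 0 < Real.log z := Real.log_pos (by linarith)
  have hK0 : 0 ≤ K := by
    have := hK z hz a hsm 0 0 le_rfl
    have h0 : (0 : ℝ) ≤ K * (0 / ((Nat.totient a : ℝ) * Real.log z) + z ^ (10 : ℕ)) :=
      le_trans (Nat.cast_nonneg _) this
    rw [zero_div, zero_add] at h0
    exact nonneg_of_mul_nonneg_left h0 (by positivity)
  set B := roughIcc ⌈z⌉₊ (x / a) with hBdef
  have hB : ∀ b ∈ B, b.Coprime a := fun b hb => (coprime_of_smooth_of_mem_roughIcc hsm hb).symm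
  set y : ℝ := (x : ℝ) / a with hy
  have hy0 : 0 ≤ y := by positivity
  have hyx : ((x / a : ℕ) : ℝ) ≤ y := Nat.cast_div_le
  -- the sieve error term is absorbed: `z^10 ≤ y/(φ(a) log z) ≤ y/log z`
  have hcond' : z ^ (10 : ℕ) ≤ y / Real.log z := by
    refine hcond.trans ?_
    rw [div_le_div_iff_of_pos_left] <;> try positivity
    · calc Real.log z = 1 * Real.log z := (one_mul _).symm
        _ ≤ (Nat.totient a : ℝ) * Real.log z := mul_le_mul_of_nonneg_right hφ1 hlogz.le
    · -- `0 < y`: from `hcond`, `z^10 > 0`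
      by_contra hy'
      have hy00 : y = 0 := le_antisymm (not_lt.1 hy') hy0
      rw [hy00, zero_div] at hcond
      linarith [pow_pos (by linarith : (0 : ℝ) < z) 10]
  -- residue classes: `M = 2K y/(φ(a) log z)`
  set M : ℝ := 2 * K * (y / ((Nat.totient a : ℝ) * Real.log z)) with hMdef
  have hM : ∀ s : ℕ, (#(B.filter (fun b : ℕ => b ≡ s [MOD a])) : ℝ) ≤ M := by
    intro s
    refine (card_roughIcc_filter_modEq_le hK hz hsm s (x / a)).trans ?_
    rw [hMdef]
    have h1 : ((x / a : ℕ) : ℝ) / ((Nat.totient a : ℝ) * Real.log z) ≤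
        y / ((Nat.totient a : ℝ) * Real.log z) :=
      div_le_div_of_nonneg_right hyx (by positivity)
    nlinarith
  -- `Σ₅ ≤ Ξ² · 2K y/log z`
  have hS5 : ∑ b ∈ B, (polyRootCountMod ![f] b : ℝ) ^ 2 ≤ Ξ ^ 2 * (2 * K * (y / Real.log z)) := by
    calc ∑ b ∈ B, (polyRootCountMod ![f] b : ℝ) ^ 2 ≤ ∑ b ∈ B, Ξ ^ 2 :=
          Finset.sum_le_sum fun b hb => pow_le_pow_left₀ (Nat.cast_nonneg _) (hΞ b hb) 2
      _ = #B * Ξ ^ 2 := by rw [Finset.sum_const, nsmul_eq_mul]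
      _ ≤ (K * (((x / a : ℕ) : ℝ) / Real.log z + z ^ (10 : ℕ))) * Ξ ^ 2 :=
          mul_le_mul_of_nonneg_right (card_roughIcc_le hK hz (x / a)) (sq_nonneg _)
      _ ≤ (2 * K * (y / Real.log z)) * Ξ ^ 2 := by
          refine mul_le_mul_of_nonneg_right ?_ (sq_nonneg _)
          have h1 : ((x / a : ℕ) : ℝ) / Real.log z ≤ y / Real.log z :=
            div_le_div_of_nonneg_right hyx hlogz.le
          nlinarith
      _ = Ξ ^ 2 * (2 * K * (y / Real.log z)) := by ring
  -- Cauchy–Schwarz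
  have hCS := norm_sum_polyRootWeylSum_mul_sq_le f h B hB hM
  have hgcd : (Int.gcd h a : ℝ) ≤ h.natAbs := by
    rw [Int.gcd_eq_natAbs]
    exact_mod_cast Nat.le_of_dvd (Int.natAbs_pos.2 hh) (Nat.gcd_dvd_left _ _)
  have hρa : (0 : ℝ) ≤ polyRootCountMod ![f] a := Nat.cast_nonneg _
  set Q : ℝ := (polyRootCountMod ![f] a : ℝ) * a / Nat.totient a with hQ
  have hQ0 : 0 ≤ Q := by positivity
  set P : ℝ := 2 * K * Ξ * (y / Real.log z) with hP
  have hP0 : 0 ≤ P := by positivity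
  have hsq : ‖∑ b ∈ B, polyRootWeylSum f (a * b) h‖ ^ 2 ≤ (P * Real.sqrt (h.natAbs) * Real.sqrt Q) ^ 2 := by
    refine hCS.trans ?_
    have e : (P * Real.sqrt (h.natAbs) * Real.sqrt Q) ^ 2 = P ^ 2 * (h.natAbs : ℝ) * Q := by
      rw [mul_pow, mul_pow, Real.sq_sqrt (Nat.cast_nonneg _), Real.sq_sqrt hQ0]
    rw [e]
    calc (∑ b ∈ B, (polyRootCountMod ![f] b : ℝ) ^ 2) * (M * ((Int.gcd h a : ℝ) * a * polyRootCountMod ![f] a))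
        ≤ (Ξ ^ 2 * (2 * K * (y / Real.log z))) * (M * ((h.natAbs : ℝ) * a * polyRootCountMod ![f] a)) := by
          have hM0 : 0 ≤ M := by positivity
          gcongr
      _ = P ^ 2 * (h.natAbs : ℝ) * Q := by
          rw [hP, hMdef, hQ]
          field_simp
  have hfinal : ‖∑ b ∈ B, polyRootWeylSum f (a * b) h‖ ≤ P * Real.sqrt (h.natAbs) * Real.sqrt Q :=
    le_of_pow_le_pow_left₀ two_ne_zero (by positivity) hsq
  refine hfinal.trans (le_of_eq ?_)
  rw [hP, hy]
  ring

end Core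



/-! ### The main estimate and Hooley's theorem -/

section Main

/-- `(x^{1/3})³ = x` for `x ≥ 0`. [folklore] -/
theorem rpow_third_pow_three {x : ℝ} (hx : 0 ≤ x) : (x ^ ((1 : ℝ) / 3)) ^ 3 = x := by
  rw [← Real.rpow_natCast, ← Real.rpow_mul hx]
  norm_num

/-- **Hooley's estimate for `R_f(h, x) = ∑_{k ≤ x} S_f(h, k)`, explicit form.**  Let
`f ∈ ℤ[X]` be irreducible of degree `n ≥ 2` and `h ≠ 0`.  There are `δ ∈ (0, 1/2]` and
`A₁, A₂, B ≥ 0` (depending on `f, h`) such that for all `x ∈ ℕ`, real `z ≥ 4` and `t ≥ 0` with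
`3t ≤ log z` and `z^{10} log z ≤ x^{1/3}`,
`|R_f(h, x)| ≤ n^{log x/log z} · x · (A₁ (log z)^{-δ} + A₂ e^{B t e^t} (log z) e^{-(t/3)(log x/log z)})`.
The first term is Hooley's `Σ₁` (moduli with smooth part `k₁ ≤ x^{1/3}`: Lemma 1, Cauchy–Schwarz,
the sieve bound for the rough cofactors in progressions, the twisted second moment, and the
`k₁`-sum with the saving `n − √n` at the split primes), the second his `Σ₂` (smooth part
`> x^{1/3}`, Rankin); the factor `n^{log x/log z}` is the crude bound `ρ_f(k₂) ≤ C n^{ω(k₂)}`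
for the rough cofactor.  Hooley takes `z = x^{1/ξ}` with `ξ → ∞` slowly; below `log x/log z` is
a small multiple of `log log x`. [cite: Hooley1964, main theorem (architecture per MartinSitar2010 §3.2)] -/
theorem exists_norm_sum_polyRootWeylSum_le {f : ℤ[X]} (hirr : Irreducible f)
    (hdeg : 2 ≤ f.natDegree) {h : ℤ} (hh : h ≠ 0) :
    ∃ δ : ℝ, 0 < δ ∧ δ ≤ 1 / 2 ∧ ∃ A₁ A₂ B : ℝ, 0 ≤ A₁ ∧ 0 ≤ A₂ ∧ 0 ≤ B ∧
      ∀ (x : ℕ) (z t : ℝ), 4 ≤ z → 0 ≤ t → 3 * t ≤ Real.log z →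
        z ^ (10 : ℕ) * Real.log z ≤ (x : ℝ) ^ ((1 : ℝ) / 3) →
        ‖∑ k ∈ Icc 1 x, polyRootWeylSum f k h‖ ≤
          (f.natDegree : ℝ) ^ (Real.log x / Real.log z) * x *
            (A₁ * Real.log z ^ (-δ) +
              A₂ * Real.exp (B * t * Real.exp t) * Real.log z *
                Real.exp (-(t / 3) * (Real.log x / Real.log z))) := by
  have hdeg0 : 0 < f.natDegree := by omega
  obtain ⟨C₀, -, hC₀⟩ := exists_polyRootCountMod_le_mul_pow_card_primeFactors hirr hdeg0
  obtain ⟨K, hKpos, hK⟩ := card_roughAP_le_of_smooth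
  obtain ⟨CR, B, hCR, hB0, hR⟩ := exists_sum_smooth_rootCount_div_le hirr hdeg0
  obtain ⟨δ, hδ, hδ2, Cg, hCg, hG⟩ := exists_sum_smooth_sqrt_rootCount_div_le hirr hdeg
  refine ⟨δ, hδ, hδ2, 2 * K * Real.sqrt (h.natAbs) * C₀ * Cg, C₀ * CR, B, by positivity,
    by positivity, hB0, fun x z t hz ht htz hzx => ?_⟩
  set n : ℕ := f.natDegree with hn
  set N : ℕ := ⌈z⌉₊ with hN
  have hz1 : 1 < z := by linarith
  have hz2 : 2 ≤ z := by linarith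
  have hz3 : 3 ≤ z := by linarith
  have hz0 : 0 < z := by linarith
  have hlogz : 0 < Real.log z := Real.log_pos hz1
  set w : ℝ := (x : ℝ) ^ ((1 : ℝ) / 3) with hw
  have hw0' : 0 ≤ w := by positivity
  have hw3 : w ^ 3 = x := rpow_third_pow_three (Nat.cast_nonneg x)
  -- `x ≥ 1`
  have hzw : 0 < z ^ (10 : ℕ) * Real.log z := by positivity
  have hwpos : 0 < w := lt_of_lt_of_le hzw hzx
  have hx0' : (0 : ℝ) < x := by rw [← hw3]; positivity
  -- the uniform bound for `ρ_f` on the rough cofactors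
  set Ξ : ℝ := C₀ * (n : ℝ) ^ (Real.log x / Real.log z) with hΞ
  have hΞ0 : 0 ≤ Ξ := by positivity
  have hΞb : ∀ a ∈ Nat.smoothNumbersUpTo x N, ∀ b ∈ roughIcc N (x / a),
      (polyRootCountMod ![f] b : ℝ) ≤ Ξ := by
    intro a _ b hb
    have hb' := mem_roughIcc.1 hb
    exact polyRootCountMod_le_of_rough hC₀ hdeg0 hz1 (by omega) (hb'.1.2.trans (Nat.div_le_self x a))
      (le_of_mem_roughIcc_ceil hb)
  -- the smooth–rough decomposition, split at `a³ ≤ x`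
  rw [sum_Icc_eq_sum_smooth_sum_rough (fun k => polyRootWeylSum f k h) N x]
  set S := Nat.smoothNumbersUpTo x N with hS
  have hSsm : ∀ k ∈ S, k ∈ Nat.smoothNumbers N := fun k hk => (Nat.mem_smoothNumbersUpTo.1 hk).2
  set T : ℕ → ℂ := fun a => ∑ b ∈ roughIcc N (x / a), polyRootWeylSum f (a * b) h with hT
  have hsplit : ∑ a ∈ S, T a =
      ∑ a ∈ S.filter (fun a => a ^ 3 ≤ x), T a + ∑ a ∈ S.filter (fun a => x < a ^ 3), T a := by
    rw [← Finset.sum_filter_add_sum_filter_not S (fun a => a ^ 3 ≤ x)]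
    congr 1
    refine Finset.sum_congr (Finset.filter_congr fun a _ => ?_) fun _ _ => rfl
    exact not_le
  -- `Σ₂`
  have hSig2 : ‖∑ a ∈ S.filter (fun a => x < a ^ 3), T a‖ ≤
      Ξ * x * (CR * Real.exp (B * t * Real.exp t) * Real.log z *
        Real.exp (-(t / 3) * (Real.log x / Real.log z))) := by
    refine (norm_sigma2_le f h hΞ0 hΞb).trans (mul_le_mul_of_nonneg_left ?_ (by positivity))
    -- `a³ > x` implies `a > w`
    have hsub : S.filter (fun a => x < a ^ 3) ⊆ S.filter (fun a : ℕ => w < (a : ℝ)) := by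
      intro a ha
      rw [mem_filter] at ha ⊢
      refine ⟨ha.1, ?_⟩
      by_contra hle
      rw [not_lt] at hle
      have : ((a : ℕ) : ℝ) ^ 3 ≤ w ^ 3 := pow_le_pow_left₀ (Nat.cast_nonneg a) hle 3
      rw [hw3] at this
      have h2 : (x : ℝ) < ((a ^ 3 : ℕ) : ℝ) := by exact_mod_cast ha.2
      push_cast at h2
      linarith
    calc ∑ a ∈ S.filter (fun a => x < a ^ 3), (polyRootCountMod ![f] a : ℝ) / a
        ≤ ∑ a ∈ S.filter (fun a : ℕ => w < (a : ℝ)), (polyRootCountMod ![f] a : ℝ) / a :=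
          Finset.sum_le_sum_of_subset_of_nonneg hsub fun a _ _ => by positivity
      _ ≤ CR * Real.exp (B * t * Real.exp t) * Real.log z * w ^ (-(t / Real.log z)) :=
          hR z hz3 t ht htz S hSsm w hwpos
      _ = _ := by
          congr 1
          rw [hw, ← Real.rpow_mul (Nat.cast_nonneg x), Real.rpow_def_of_pos hx0']
          congr 1
          field_simp
  -- `Σ₁`
  have hSig1 : ‖∑ a ∈ S.filter (fun a => a ^ 3 ≤ x), T a‖ ≤
      Ξ * x * (2 * K * Real.sqrt (h.natAbs) * Cg * Real.log z ^ (-δ)) := by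
    have hterm : ∀ a ∈ S.filter (fun a => a ^ 3 ≤ x), ‖T a‖ ≤
        (2 * K * Real.sqrt (h.natAbs) * Ξ * ((x : ℝ) / Real.log z)) *
          (Real.sqrt ((polyRootCountMod ![f] a : ℝ) * a / Nat.totient a) / a) := by
      intro a ha
      rw [mem_filter] at ha
      obtain ⟨haS, ha3⟩ := ha
      have hsm := hSsm a haS
      have ha0 : a ≠ 0 := Nat.ne_zero_of_mem_smoothNumbers hsm
      have hapos : (0 : ℝ) < a := by exact_mod_cast Nat.pos_of_ne_zero ha0
      have hφ0 : (0 : ℝ) < Nat.totient a := by exact_mod_cast Nat.totient_pos.2 (Nat.pos_of_ne_zero ha0)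
      have hφa : (Nat.totient a : ℝ) ≤ a := by exact_mod_cast Nat.totient_le a
      -- `a ≤ w`
      have haw : (a : ℝ) ≤ w := by
        have h3 : ((a : ℕ) : ℝ) ^ 3 ≤ w ^ 3 := by
          rw [hw3]; exact_mod_cast ha3
        exact le_of_pow_le_pow_left₀ (by norm_num) hw0' h3
      -- the absorption condition
      have hcond : z ^ (10 : ℕ) ≤ ((x : ℝ) / a) / ((Nat.totient a : ℝ) * Real.log z) := by
        rw [le_div_iff₀ (by positivity), le_div_iff₀ hapos]
        calc z ^ (10 : ℕ) * ((Nat.totient a : ℝ) * Real.log z) * a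
            ≤ (z ^ (10 : ℕ) * Real.log z) * (a * a) := by
              have : z ^ (10 : ℕ) * ((Nat.totient a : ℝ) * Real.log z) * a =
                (z ^ (10 : ℕ) * Real.log z) * (Nat.totient a * a) := by ring
              rw [this]
              exact mul_le_mul_of_nonneg_left (mul_le_mul_of_nonneg_right hφa hapos.le) hzw.le
          _ ≤ w * (w * w) := by
              refine mul_le_mul hzx ?_ (by positivity) hw0'
              exact mul_le_mul haw haw hapos.le hw0'
          _ = x := by rw [← hw3]; ring
      refine (norm_sigma1_term_le f h hK hh hz2 haS hΞ0 (hΞb a haS) hcond).trans (le_of_eq ?_)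
      field_simp
    calc ‖∑ a ∈ S.filter (fun a => a ^ 3 ≤ x), T a‖
        ≤ ∑ a ∈ S.filter (fun a => a ^ 3 ≤ x), ‖T a‖ := norm_sum_le _ _
      _ ≤ ∑ a ∈ S.filter (fun a => a ^ 3 ≤ x),
            (2 * K * Real.sqrt (h.natAbs) * Ξ * ((x : ℝ) / Real.log z)) *
              (Real.sqrt ((polyRootCountMod ![f] a : ℝ) * a / Nat.totient a) / a) :=
          Finset.sum_le_sum hterm
      _ = (2 * K * Real.sqrt (h.natAbs) * Ξ * ((x : ℝ) / Real.log z)) *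
            ∑ a ∈ S.filter (fun a => a ^ 3 ≤ x),
              Real.sqrt ((polyRootCountMod ![f] a : ℝ) * a / Nat.totient a) / a := by
          rw [Finset.mul_sum]
      _ ≤ (2 * K * Real.sqrt (h.natAbs) * Ξ * ((x : ℝ) / Real.log z)) *
            ∑ a ∈ S, Real.sqrt ((polyRootCountMod ![f] a : ℝ) * a / Nat.totient a) / a := by
          refine mul_le_mul_of_nonneg_left ?_ (by positivity)
          exact Finset.sum_le_sum_of_subset_of_nonneg (Finset.filter_subset _ _)
            fun a _ _ => by positivity
      _ ≤ (2 * K * Real.sqrt (h.natAbs) * Ξ * ((x : ℝ) / Real.log z)) * (Cg * Real.log z ^ (1 - δ)) :=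
          mul_le_mul_of_nonneg_left (hG z hz S hSsm) (by positivity)
      _ = Ξ * x * (2 * K * Real.sqrt (h.natAbs) * Cg * Real.log z ^ (-δ)) := by
          rw [show (-δ) = (1 - δ) - 1 by ring, Real.rpow_sub_one hlogz.ne']
          field_simp
  -- combine
  calc ‖∑ a ∈ S, T a‖
      = ‖∑ a ∈ S.filter (fun a => a ^ 3 ≤ x), T a + ∑ a ∈ S.filter (fun a => x < a ^ 3), T a‖ := by
        rw [hsplit]
    _ ≤ ‖∑ a ∈ S.filter (fun a => a ^ 3 ≤ x), T a‖ + ‖∑ a ∈ S.filter (fun a => x < a ^ 3), T a‖ :=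
        norm_add_le _ _
    _ ≤ Ξ * x * (2 * K * Real.sqrt (h.natAbs) * Cg * Real.log z ^ (-δ)) +
          Ξ * x * (CR * Real.exp (B * t * Real.exp t) * Real.log z *
            Real.exp (-(t / 3) * (Real.log x / Real.log z))) := add_le_add hSig1 hSig2
    _ = _ := by rw [hΞ]; ring


/-- **Hooley's theorem (1964), discharged**: for `f ∈ ℤ[X]` irreducible of degree `n ≥ 2` and
`h ≠ 0`, `∑_{d ≤ D} S_f(h, d) = o(D)`; i.e. the named fact `hooley_polyRoots_equidistributed`
holds.  From `exists_norm_sum_polyRootWeylSum_le` with `log z = log x / (ε log log x)`,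
`ε = δ/(2 log n)`, `t = 3(2 + δ/2)/ε`: the bound becomes
`x · (A₁ ε^δ s^δ e^{-δ s/2} + (A₂'/ε) e^{-s}/s)` with `s = log log x → ∞`.
[cite: Hooley1964, main theorem]; architecture [cite: MartinSitar2010, §3.2];
exponent bookkeeping [cite: DartygeMartin2019, Lemma 5 (k = 1)]. -/
theorem hooley_polyRoots_equidistributed_holds : hooley_polyRoots_equidistributed := by
  rw [hooley_polyRoots_equidistributed_iff]
  intro f hdeg hirr h hh
  obtain ⟨δ, hδ, hδ2, A₁, A₂, B, hA₁, hA₂, hB, hcore⟩ :=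
    exists_norm_sum_polyRootWeylSum_le hirr hdeg hh
  set n : ℕ := f.natDegree with hn
  have hn2 : (2 : ℝ) ≤ n := by rw [hn]; exact_mod_cast hdeg
  have hn0 : (0 : ℝ) < n := by linarith
  have hlogn : 0 < Real.log n := Real.log_pos (by linarith)
  -- parameters
  set ε : ℝ := δ / (2 * Real.log n) with hε
  have hε0 : 0 < ε := by positivity
  have hεn : Real.log n * ε = δ / 2 := by rw [hε]; field_simp
  set t : ℝ := 3 * (2 + δ / 2) / ε with ht
  have ht0 : 0 ≤ t := by positivity
  have htε : t / 3 * ε = 2 + δ / 2 := by rw [ht]; field_simp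
  set A₂' : ℝ := A₂ * Real.exp (B * t * Real.exp t) with hA₂'
  have hA₂'0 : 0 ≤ A₂' := by positivity
  -- the limit function of `s = log log x`
  set Ψ : ℝ → ℝ := fun s => A₁ * ε ^ δ * (s ^ δ * Real.exp (-(δ / 2) * s)) +
    A₂' / ε * Real.exp (-s) with hΨ
  have hΨ0 : Filter.Tendsto Ψ Filter.atTop (nhds 0) := by
    have h1 := (tendsto_rpow_mul_exp_neg_mul_atTop_nhds_zero δ (δ / 2) (by positivity)).const_mul
      (A₁ * ε ^ δ)
    have h2 := Real.tendsto_exp_neg_atTop_nhds_zero.const_mul (A₂' / ε)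
    simpa [hΨ] using h1.add h2
  -- basic limits in `x`
  have hL : Filter.Tendsto (fun x : ℕ => Real.log (x : ℝ)) Filter.atTop Filter.atTop :=
    Real.tendsto_log_atTop.comp tendsto_natCast_atTop_atTop
  have hLL : Filter.Tendsto (fun x : ℕ => Real.log (Real.log (x : ℝ))) Filter.atTop Filter.atTop :=
    Real.tendsto_log_atTop.comp hL
  -- the thresholds
  set c₁ : ℝ := max 2 (3 * t) with hc₁
  have hc₁0 : 0 < c₁ := lt_of_lt_of_le two_pos (le_max_left _ _)
  set s₀ : ℝ := max 1 (33 / ε) with hs₀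
  refine Asymptotics.isLittleO_iff.2 fun c hc => ?_
  have hev1 : ∀ᶠ x : ℕ in Filter.atTop, Ψ (Real.log (Real.log (x : ℝ))) ≤ c :=
    (hΨ0.comp hLL).eventually (Iic_mem_nhds hc)
  have hev2 : ∀ᶠ x : ℕ in Filter.atTop,
      ‖Real.log (Real.log (x : ℝ))‖ ≤ (1 / (ε * c₁)) * ‖Real.log (x : ℝ)‖ :=
    hL.eventually (Real.isLittleO_log_id_atTop.bound (by positivity))
  have hev3 : ∀ᶠ x : ℕ in Filter.atTop, s₀ ≤ Real.log (Real.log (x : ℝ)) :=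
    hLL.eventually_ge_atTop s₀
  have hev4 : ∀ᶠ x : ℕ in Filter.atTop, (3 : ℝ) ≤ Real.log (x : ℝ) := hL.eventually_ge_atTop 3
  filter_upwards [hev1, hev2, hev3, hev4] with x h1 h2 h3 h4
  -- notation
  set L : ℝ := Real.log (x : ℝ) with hLdef
  set s : ℝ := Real.log L with hsdef
  have hL0 : 0 < L := by linarith
  have hx1 : (1 : ℝ) < x := by
    by_contra hle
    rw [not_lt] at hle
    have : L ≤ 0 := Real.log_nonpos (Nat.cast_nonneg x) hle
    linarith
  have hx0 : (0 : ℝ) < x := by linarith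
  have hs1 : 1 ≤ s := le_trans (le_max_left _ _) h3
  have hs0 : 0 < s := by linarith
  have hs33 : 33 / ε ≤ s := le_trans (le_max_right _ _) h3
  have hexps : Real.exp s = L := by rw [hsdef, Real.exp_log hL0]
  set u : ℝ := L / (ε * s) with hudef
  have hεs0 : 0 < ε * s := by positivity
  have hu0 : 0 < u := by positivity
  have hLu : L / u = ε * s := by
    rw [hudef]; field_simp
  -- `u ≥ c₁`, from `log L ≤ L/(ε c₁)`
  have huc : c₁ ≤ u := by
    have h2' : s ≤ (1 / (ε * c₁)) * L := by
      have := h2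
      rw [Real.norm_of_nonneg hs0.le, Real.norm_of_nonneg hL0.le] at this
      exact this
    rw [hudef, le_div_iff₀ hεs0]
    calc c₁ * (ε * s) ≤ c₁ * (ε * ((1 / (ε * c₁)) * L)) := by gcongr
      _ = L := by field_simp
  have hu2 : 2 ≤ u := le_trans (le_max_left _ _) huc
  have hu3t : 3 * t ≤ u := le_trans (le_max_right _ _) huc
  -- the parameter `z = e^u`
  set z : ℝ := Real.exp u with hzdef
  have hlogz : Real.log z = u := by rw [hzdef, Real.log_exp]
  have hz4 : 4 ≤ z := by
    rw [hzdef]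
    have h22 : Real.exp 2 ≤ Real.exp u := Real.exp_le_exp.2 hu2
    have : (4 : ℝ) ≤ Real.exp 2 := by
      have := Real.add_one_le_exp (1 : ℝ)
      have h' : Real.exp 2 = Real.exp 1 * Real.exp 1 := by rw [← Real.exp_add]; norm_num
      nlinarith [Real.exp_pos (1 : ℝ)]
    linarith
  -- the absorption condition `z^10 log z ≤ x^{1/3}`
  have hcond : z ^ (10 : ℕ) * Real.log z ≤ (x : ℝ) ^ ((1 : ℝ) / 3) := by
    rw [hlogz, hzdef, ← Real.exp_nat_mul, Real.rpow_def_of_pos hx0, ← hLdef]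
    have hu_exp : u ≤ Real.exp u := by linarith [Real.add_one_le_exp u]
    calc Real.exp ((10 : ℕ) * u) * u ≤ Real.exp ((10 : ℕ) * u) * Real.exp u :=
          mul_le_mul_of_nonneg_left hu_exp (Real.exp_pos _).le
      _ = Real.exp (11 * u) := by rw [← Real.exp_add]; push_cast; ring_nf
      _ ≤ Real.exp (L * (1 / 3)) := by
          rw [Real.exp_le_exp, hudef]
          have h33 : 33 ≤ ε * s := by
            rw [div_le_iff₀ hε0] at hs33; linarith
          rw [show 11 * (L / (ε * s)) = L * (11 / (ε * s)) by ring]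
          refine mul_le_mul_of_nonneg_left ?_ hL0.le
          rw [div_le_iff₀ hεs0]
          linarith
  -- apply the main estimate
  have hb := hcore x z t hz4 ht0 (by rw [hlogz]; exact hu3t) hcond
  rw [hlogz, hLu] at hb
  -- identify the two terms
  have hΞ : (n : ℝ) ^ (ε * s) = Real.exp (δ / 2 * s) := by
    rw [Real.rpow_def_of_pos hn0, ← mul_assoc, hεn]
  have hT1 : (n : ℝ) ^ (ε * s) * (A₁ * u ^ (-δ)) =
      A₁ * ε ^ δ * (s ^ δ * Real.exp (-(δ / 2) * s)) := by
    rw [hΞ, hudef, Real.rpow_def_of_pos hu0, Real.log_div hL0.ne' hεs0.ne', ← hsdef]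
    have e1 : ε ^ δ * s ^ δ = Real.exp (Real.log (ε * s) * δ) := by
      rw [← Real.mul_rpow hε0.le hs0.le, Real.rpow_def_of_pos hεs0]
    calc Real.exp (δ / 2 * s) * (A₁ * Real.exp ((s - Real.log (ε * s)) * -δ))
        = A₁ * (Real.exp (Real.log (ε * s) * δ) * Real.exp (-(δ / 2) * s)) := by
          rw [mul_comm (Real.exp (δ / 2 * s)), mul_assoc, ← Real.exp_add, ← Real.exp_add]
          congr 2
          ring
      _ = A₁ * ε ^ δ * (s ^ δ * Real.exp (-(δ / 2) * s)) := by rw [← e1]; ring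
  have hT2 : (n : ℝ) ^ (ε * s) * (A₂ * Real.exp (B * t * Real.exp t) * u *
      Real.exp (-(t / 3) * (ε * s))) = A₂' / (ε * s) * Real.exp (-s) := by
    rw [hΞ, hA₂', hudef, ← hexps]
    have e1 : -(t / 3) * (ε * s) = -((t / 3 * ε) * s) := by ring
    rw [e1, htε]
    calc Real.exp (δ / 2 * s) * (A₂ * Real.exp (B * t * Real.exp t) * (Real.exp s / (ε * s)) *
          Real.exp (-((2 + δ / 2) * s)))
        = A₂ * Real.exp (B * t * Real.exp t) / (ε * s) *
            (Real.exp (δ / 2 * s) * Real.exp s * Real.exp (-((2 + δ / 2) * s))) := by ring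
      _ = A₂ * Real.exp (B * t * Real.exp t) / (ε * s) * Real.exp (-s) := by
          rw [← Real.exp_add, ← Real.exp_add]
          congr 2
          ring
  have hT2le : A₂' / (ε * s) * Real.exp (-s) ≤ A₂' / ε * Real.exp (-s) := by
    refine mul_le_mul_of_nonneg_right ?_ (Real.exp_pos _).le
    refine div_le_div_of_nonneg_left hA₂'0 hε0 ?_
    calc ε = ε * 1 := (mul_one ε).symm
      _ ≤ ε * s := mul_le_mul_of_nonneg_left hs1 hε0.le
  -- conclude
  have hxn : ‖((x : ℝ) : ℝ)‖ = x := by simp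
  rw [hxn]
  calc ‖∑ d ∈ Icc 1 x, polyRootWeylSum f d h‖
      ≤ (n : ℝ) ^ (ε * s) * x * (A₁ * u ^ (-δ) +
          A₂ * Real.exp (B * t * Real.exp t) * u * Real.exp (-(t / 3) * (ε * s))) := hb
    _ = x * ((n : ℝ) ^ (ε * s) * (A₁ * u ^ (-δ)) + (n : ℝ) ^ (ε * s) *
          (A₂ * Real.exp (B * t * Real.exp t) * u * Real.exp (-(t / 3) * (ε * s)))) := by ring
    _ = x * (A₁ * ε ^ δ * (s ^ δ * Real.exp (-(δ / 2) * s)) + A₂' / (ε * s) * Real.exp (-s)) := by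
        rw [hT1, hT2]
    _ ≤ x * Ψ s := by
        refine mul_le_mul_of_nonneg_left ?_ hx0.le
        simp only [hΨ]
        linarith
    _ ≤ x * c := mul_le_mul_of_nonneg_left h1 hx0.le
    _ = c * x := mul_comm _ _

end Main

end Literature.NumberTheory.Sieve
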